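import Summits.FinalStateConjecture.FinalStateConjecture.Theses.StarvedNecks
import Literature.Geometry.Lorentzian.KerrSchildWaveCauchyProblem
import Summits.FinalStateConjecture.FinalStateConjecture.Theorems.StarvedNecksNecksCertifyStubSeamFlatRestrict
import Summits.FinalStateConjecture.FinalStateConjecture.Theorems.StarvedNecksNecksCertifyStubSeamClockRadii
import Summits.FinalStateConjecture.FinalStateConjecture.Theorems.StarvedNecksNecksCertifyStubSphereMeanDarboux
import Summits.FinalStateConjecture.FinalStateConjecture.Theorems.StarvedNecksNecksCertifyStubSphericalMeansCalculus
import Summits.FinalStateConjecture.FinalStateConjecture.Theorems.StarvedNecksNecksCertifyStubKirchhoffFormula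
import Summits.FinalStateConjecture.FinalStateConjecture.Theorems.StarvedNecksNecksCertifyStubSeamSurgeryMain
import Summits.FinalStateConjecture.FinalStateConjecture.Theorems.StarvedNecksNecksCertifyStubHuygensNeck
import Summits.FinalStateConjecture.FinalStateConjecture.Theorems.StarvedNecksNecksCertifyStubConeSeparation
import Summits.FinalStateConjecture.FinalStateConjecture.Theorems.StarvedNecksNecksCertifyStubChartSurgery
import Summits.FinalStateConjecture.FinalStateConjecture.Theorems.StarvedNecksNecksCertifyStubNeckLedgerAnalysisZero
import HarnessLib.Audit

/-!
# Line `two-cap-focusing-ledger` — crux `StarvedNecks.NecksCertify` (stmt-FinalStateConjecture-13549)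

Lead's skeleton (prover-line-stmt-FinalStateConjecture-13549-0, 2026-08-16; picked line
`two-cap-focusing-ledger`, planner skeleton `Lines/two_cap_focusing_ledger.lean` of
planner-cruxplan-…-two-cap-focusing-led-0, RESHAPED as recorded below).  Crux (FIXED, concluded BY
NAME by `NecksCertify_of`): every honest fixed-radius `C⁴` final-state decomposition of an admissible
MGHD can be re-seamed into a `C²` decomposition of the same exterior that is `HonestCore ∧ SEAMED`
(`Summit.FinalStateConjecture.FinalStateConjecture.Theses.StarvedNecks.NecksCertify`).

## The line in one paragraph

The neck of hole `i` at a late time `t` — the annulus `{R₁ ≤ rᵢ ≤ ρₐ(t)}` between a certified near-zone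
radius and a sublinear majorant of the flat chart's tube wall — is reached, by the sharp Huygens
principle of the flat model, ONLY through (o) the certified cylinder (own late emission, a Duhamel term
at retarded time `t − rᵢ → ∞`) and (w) the backward null cone of the neck point truncated to radii
`σ ∈ [4ρₐ, 5ρₐ]`, which lies in the flat-certified zone.  Kirchhoff's representation at radius `σ`
converts `Cᵏ` control at the apex into the flat `Cᵏ` certificate on the far sphere PLUS
`σ × (sphere average of ONE MORE derivative)`; by Cauchy–Schwarz and a pigeonhole in `σ` that focusing
factor is paid by the CONE LEDGER `ρₐ⁻¹ ∫_{cone shell} |∂^{k+1}|² → 0` (starved commuted flux per unit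
wall radius — `L²`, hence focusing-blind, provenance-blind and frame-blind).  The model rung M2
(`HuygensNeckLemma`) is this statement for `□_η φ = 0` outside a cylinder, from Kirchhoff's formula
(R1, itself from Darboux's equation for spherical means); the physics rung N1a runs it on the Einstein
equations and delivers the audited `NeckAtlas`; N2 seams the atlas into the crux's `∃ d₂ R R₀'`.

## Registered stubs (lead's reshape, 2026-08-16) and the composition

* `stub_sphereMeanDarboux` (R1a-i, M–L, classical): Darboux's equation for spherical means on `E3`
  (`(ρ·⨍f(x+ρ·))'' = ρ·⨍Δf(x+ρ·)`; proof route: rotation invariance of `volume.toSphere` ⇒ angular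
  derivatives integrate to zero ⇒ `⨍Δ_{S²} = 0`), with smoothness and the first-derivative formula.
* `stub_sphericalMeansCalculus` (R1a-ii, M): `SphereMeanDarboux →` the time-dependent spherical means
  `A(s,r) = ∫ψ(s, x+rw)` of a smooth `ψ : E4 → ℝ` are jointly smooth, with `∂ᵣA`, `∂ₛA`, `∂ₛ²A` by
  differentiation under the integral and Darboux for `∂ᵣ²(rA)`.
* `stub_kirchhoffFormula` (R1b, M): `SphericalMeansCalculus →` Kirchhoff–Duhamel on `ℝ¹⁺³` (the
  planner's R1 text verbatim as conclusion): `Ũ = rA` solves the 1+1 equation `Ũₛₛ − Ũᵣᵣ = −r⨍□ψ`,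
  transport `Ũₛ + Ũᵣ` along the characteristic from `(t−σ, σ)` to `(t, 0)` (tree dictionary:
  `Theorems/StarvedNecksNecksCertifyStubCharacteristicCalculus`, `…PhotonSphereChannelsBlindnessWaveCalculus`).
* `stub_huygensNeck` (M2, L, the lever; planner's text verbatim): `KirchhoffFormula → HuygensNeckLemma`.
* `stub_neckLedgerAnalysis` (N1a, XL, HARDEST, physics; lead): `HuygensNeckLemma → KirchhoffFormula →`
  for every admissible datum / MGHD / honest `C⁴` decomposition, a `NeckAtlas` (A1–A13).  The planner's
  internal cut `NeckCertificate → (chart surgery) → LedgerAtlas` is folded into this stub (its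
  `LedgerAtlas` lacked A12/A13, which the sibling line's N2 audit showed the seam cannot do without; the
  re-centring/fattening device of the planner's N1b is the intended LAST STEP of N1a's proof, recorded in
  its docstring).  False modulo the comoving-binary `H` exactly as the crux (A9+A10).
* `stub_seamSurgery` (N2, L–XL packaging): `SeamClockRadii → SeamFlatRestrict →` for every such input
  with a `NeckAtlas`, `∃ d₂ R R₀'` with `O = exteriorOf d₂.charted ∧ HonestCore d₂ R₀' ∧ Seamed d₂ R R₀'`
  — the sibling line's registered N2 over the adjusted atlas; its two antecedents are LANDED
  (`Theorems/StarvedNecksNecksCertifyStubSeamClockRadii`, p81554; `…StubSeamFlatRestrict`, p78126) and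
  are discharged in `NecksCertify_of` by the imported theorems.

v5 (continuation lead prover-line-stmt-FinalStateConjecture-13549-c1-0, 2026-08-16): the two open
stubs of v4 are cut by HOLE COUNT, where their content actually lives —
* `stub_distinctVelocitiesMulti` (DVMulti): DV restricted to inputs with `2 ≤ d.N` (the defect; the
  `d.N ≤ 1` part is vacuous and proved here, `distinctVelocities_of_N_le_one`);
* `stub_neckLedgerAnalysisZero` (N1a′₀, `d.N = 0`, causal bookkeeping, provable now) and
  `stub_neckLedgerAnalysisPos` (N1a′₊, `0 < d.N`, the physics under DV); the former registered
  `stub_neckLedgerAnalysis` is now a theorem from the two.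
N1a′₀ LANDED this seat (p116183, imported; its `sorry` is gone), so the open registered stubs are DVMulti
and N1a′₊ only.  Consequences recorded as theorems (Theorems-side copies in
`Theorems/StarvedNecksNecksCertifyReductionZero.lean`, p116546): `necksCertify_repaired_of`
(NecksCertify[C′] ⇐ N1a′₊), `necksCertify_of_N_le_one` (the crux AS FILED for `d.N ≤ 1` ⇐ N1a′₊, no
defect stub) and `necksCertify_of_N_eq_zero` (the crux AS FILED for `d.N = 0`, UNCONDITIONAL).

`NecksCertify_of : R1a-i → R1a-ii → R1b → M2 → N1a → N2 → NecksCertify` is PROVED below (pure logic).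
Namespace `…Cruxes.NecksCertify.TwoCapFocusingLedger`; registered signatures are the theorem headers of
`stub_*` (fully unfolded model rungs; physics rungs by the names of the bundle `def`s).  Disproof.lean
(gen 2) read: no `_false_without_` theorem exists; §T.4's `NoParkingDecaySharp` does not touch this
line (no Bargmann threshold); §4/§6 negative lemma honoured by localising the defect in N1a; §5 and §E
are N2's tools.
-/

noncomputable section

open scoped Manifold ContDiff Topology ENNReal
open Filter Set MeasureTheory Topology Literature.Geometry.Lorentzian

namespace Summit.FinalStateConjecture.FinalStateConjecture.Cruxes.NecksCertify.TwoCapFocusingLedger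

set_option linter.dupNamespace false
set_option linter.unusedVariables false

/-! ## The crux's let-bound bundles, named (verbatim copies of `StarvedNecks.NecksCertify`) -/

/-- `HonestCore` = the crux's `Hc` (verbatim): sub-extremal holes, `100·Mᵢ ≤ R₀`, orthochronous
boosts; anchoring of hole-late points below later discs of every radius `≥ R₀`; relative closedness
of late tube portions; future-oriented flat chart. -/
def HonestCore (𝓢 : Spacetime.{0} 4) (O : Set 𝓢.carrier) (k : ℕ) (d : FinalStateDecomposition 𝓢 O k)
    (R₀ : ℝ) : Prop :=
  let B := d.background; let t := fun i ↦ (B i).time; let r := fun i ↦ (B i).radius; let Ψ := d.chart;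
  (∀ i, Kerr.IsSubextremal (d.mass i) (d.spin i) ∧ 100 * d.mass i ≤ R₀ ∧ 0 < ((d.motion i).1 : E4 ≃L[ℝ] E4) (E4.basisVector 0) 0) ∧
    (∀ i (ϱ τ₂ : ℝ), R₀ ≤ ϱ → d.τ₀ < τ₂ → Ψ i '' {x | d.τ₀ < t i x.1 ∧ t i x.1 < τ₂ ∧ r i x.1 < ϱ} ⊆ 𝓢.metric.causalPast 𝓢.timeOrientation (Ψ i '' (B i).truncTimeSlab ϱ τ₂)) ∧
    (∀ i (τ' : ℝ) (ϱ : ℝ → ℝ), Continuous ϱ → d.τ₀ < τ' → let A := Ψ i '' {x | τ' ≤ t i x.1 ∧ r i x.1 ≤ ϱ (t i x.1)}; closure A ∩ O ⊆ A) ∧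
    (∀ y : d.flatDomain, d.τ₀ < y.1 0 → 𝓢.timeOrientation.IsFutureDirected (mfderiv 𝓘(ℝ, E4) (𝓡 4) d.flatChart y (E4.basisVector 0)))

/-- `HonestFar` = the crux's `Hf` (verbatim): flat-late points below later flat slabs; closures of far
flat slabs are flat points; eventually each hole chart is `C⁰`-honest (`1/(10‖Λᵢ‖²)`) on its own
Voronoi cell beyond `R₀` — no hidden strong field (triage: Hf(3) is load-bearing for every line). -/
def HonestFar (𝓢 : Spacetime.{0} 4) (O : Set 𝓢.carrier) (k : ℕ) (d : FinalStateDecomposition 𝓢 O k)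
    (R₀ : ℝ) : Prop :=
  let B := d.background; let t := fun i ↦ (B i).time; let r := fun i ↦ (B i).radius; let Φ := d.flatChart;
  (∀ τ₂ : ℝ, d.τ₀ < τ₂ → Φ '' {y | d.τ₀ < y.1 0 ∧ y.1 0 < τ₂} ⊆ 𝓢.metric.causalPast 𝓢.timeOrientation (Φ '' (Minkowski.backgroundOn d.flatDomain).timeSlab τ₂)) ∧
    (∀ τ' : ℝ, d.τ₀ < τ' → closure (Φ '' {y | τ' ≤ y.1 0 ∧ ∀ i, d.excision i (y.1 0) + 1 ≤ r i y.1}) ⊆ Φ '' {y | τ' ≤ y.1 0}) ∧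
    (∀ i, ∃ T : ℝ, supCkENorm (Subtype.val '' {x : (B i).domain | T ≤ t i x.1 ∧ R₀ ≤ r i x.1 ∧ ∀ j, j ≠ i → r i x.1 ≤ r j x.1}) 0 (𝓢.deviationExtend (B i) (d.chart i)) ≤ ENNReal.ofReal (1 / (10 * ‖(((d.motion i).1 : E4 ≃L[ℝ] E4) : E4 →L[ℝ] E4)‖ ^ 2)))

/-- `Seamed` = the crux's `Sm` (verbatim, 12 clauses S1–S12): radii/tube profiles; `C²` certification
out to `Rᵢ(τ)`; flat `C⁰` threshold `1/10`; hole `C⁰` threshold `1/(10‖Λᵢ‖²)` and future-directed hole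
time-lines on certified tubes; ONE ATLAS; flat-late domain = tube complement; margins 2; clock lag;
far hole leaves in the radiation zone; closures; certified tubes of different holes coordinate-disjoint
(S12 — the clause rattack's EVIDENCE.md shows unsatisfiable for equal-velocity holes; repair C′ pending
at route level). -/
def Seamed (𝓢 : Spacetime.{0} 4) (O : Set 𝓢.carrier) (d : FinalStateDecomposition 𝓢 O 2)
    (R : Fin d.N → ℝ → ℝ) (R₀ : ℝ) : Prop :=
  let B := d.background; let t := fun i ↦ (B i).time; let r := fun i ↦ (B i).radius; let Λ := fun i ↦ ((d.motion i).1 : E4 ≃L[ℝ] E4); let Φ := d.flatChart; let Ψ := d.chart; let ρ := d.excision;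
  (∀ i, Monotone (R i) ∧ Continuous (R i) ∧ ∀ s, R₀ + 4 ≤ R i s ∧ R₀ ≤ ρ i s) ∧
    (∀ i, Tendsto (fun τ ↦ 𝓢.truncDeviationCk (B i) (Ψ i) 2 (R i τ) τ) atTop (𝓝 0)) ∧
    supCkENorm (Subtype.val '' {y : d.flatDomain | d.τ₀ ≤ y.1 0}) 0 (𝓢.deviationExtend (Minkowski.backgroundOn d.flatDomain) Φ) ≤ 10⁻¹ ∧
    (∀ i, supCkENorm (Subtype.val '' {x : (B i).domain | (d.τ₀ ≤ t i x.1 ∨ d.τ₀ ≤ x.1 0) ∧ R₀ ≤ r i x.1 ∧ r i x.1 ≤ R i (t i x.1)}) 0 (𝓢.deviationExtend (B i) (Ψ i)) ≤ ENNReal.ofReal (1 / (10 * ‖(Λ i : E4 →L[ℝ] E4)‖ ^ 2))) ∧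
    (∀ i (x : (B i).domain), (d.τ₀ ≤ t i x.1 ∨ d.τ₀ ≤ x.1 0) → R₀ ≤ r i x.1 → r i x.1 ≤ R i (t i x.1) → 𝓢.timeOrientation.IsFutureDirected (mfderiv 𝓘(ℝ, E4) (𝓡 4) (Ψ i) x ((Λ i) (E4.basisVector 0)))) ∧
    (∀ i (y : E4) (hy : y ∈ (B i).domain), d.τ₀ ≤ y 0 → (∀ j, ρ j (y 0) < r j y) → r i y ≤ R i (t i y) + 1 → ∃ hy' : y ∈ d.flatDomain, Ψ i ⟨y, hy⟩ = Φ ⟨y, hy'⟩) ∧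
    (∀ y : d.flatDomain, d.τ₀ ≤ y.1 0 → ∀ j, ρ j (y.1 0) < r j y.1) ∧
    (∀ j (y : E4), d.τ₀ ≤ y 0 → r j y ≤ ρ j (y 0) → r j y + 2 ≤ R j (t j y)) ∧
    (∀ j (y : E4), d.τ₀ ≤ t j y → r j y ≤ R j (t j y) + 2 → t j y ≤ y 0) ∧
    (∀ j, Ψ j '' {x | d.τ₀ < t j x.1 ∧ R j (t j x.1) + 1 < r j x.1} ⊆ d.radiationZone) ∧
    (∀ τ' : ℝ, d.τ₀ < τ' → closure (Φ '' {y | τ' ≤ y.1 0}) ⊆ Φ '' {y | τ' ≤ y.1 0} ∪ ⋃ j, Ψ j '' {x | τ' ≤ x.1 0 ∧ r j x.1 = ρ j (x.1 0)}) ∧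
    (∀ j j' (y : E4), j ≠ j' → (d.τ₀ ≤ y 0 ∨ d.τ₀ ≤ t j y) → r j y ≤ R j (t j y) + 1 → R j' (t j' y) + 1 < r j' y)



/-! ## Model rungs: spherical means (R1a), Kirchhoff (R1b) and the Huygens neck lemma (M2)

Conventions.  Spacetime functions are `φ : E4 → ℝ` on `E4 = ℝ⁴` (index `0` = time, `E4.ofTimeSpace t x`
assembles a point from `t : ℝ` and `x : E3`, `E4.spatialNorm` is `|x|`); all derivatives are Fréchet
derivatives (`fderiv`, `iteratedFDeriv`); the flat d'Alembertian is the tree's divergence-form operator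
`KerrSchild.waveOperator (fun _ ↦ Kerr.etaComp) φ = −∂ₜ²φ + Δφ`; sphere integrals are taken with
Mathlib's measure `(volume : Measure E3).toSphere` on the unit sphere `Metric.sphere (0 : E3) 1` (total
mass `4π`; averages are normalised by the total mass, so no numerical constant is hard-wired). -/

/-- **R1a-i — Darboux's equation for spherical means on `ℝ³`** (classical: Courant–Hilbert II, Ch. VI
§13.1; Evans, PDE, §2.4.1, Lemma 1 in `n = 3` after `(ρM)'' = ρ(M'' + (2/ρ)M')`).  For a smooth
`f : E3 → ℝ`, a centre `x` and the un-normalised spherical mean `M(ρ) = ∫_{S²} f(x + ρw) dσ(w)`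
(`σ = volume.toSphere`, ALL real `ρ`; `M` is even): `M` is smooth, `M'(ρ) = ∫ Df(x+ρw)·w dσ`
(differentiation under the integral), and `(ρ M(ρ))'' = ρ ∫ (Δf)(x + ρw) dσ(w)` with
`Δf = ∑ᵢ ∂ᵢ∂ᵢ f` in nested-`fderiv` form.  Suggested proof (no divergence theorem in Mathlib): the sphere
measure is invariant under linear isometries, so `θ ↦ ∫ g(e^{θA}w) dσ` is constant for skew `A`, whence
`∫ (Aw)·∇g(w) dσ = 0`; applied to `g = (Aᵢw)·∇h` and summed over the three infinitesimal rotations,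
`∑ᵢ Lᵢ² = ρ²Δ − (y·∇)² − (y·∇)` gives `∫ [Δh − wᵀD²h w − (2/ρ) w·∇h](x+ρw) dσ = 0`, i.e.
`M'' + (2/ρ)M' = ∫Δf` for `ρ ≠ 0`; `ρ = 0` by `M'(0) = 0` (oddness).  Size M–L. -/
def SphereMeanDarboux : Prop :=
  ∀ (f : E3 → ℝ), ContDiff ℝ ∞ f → ∀ (x : E3),
    ContDiff ℝ ∞ (fun ρ : ℝ ↦ ∫ (w : Metric.sphere (0 : E3) 1), f (x + ρ • (w : E3)) ∂((volume : Measure E3).toSphere)) ∧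
    (∀ r : ℝ, deriv (fun ρ : ℝ ↦ ∫ (w : Metric.sphere (0 : E3) 1), f (x + ρ • (w : E3)) ∂((volume : Measure E3).toSphere)) r =
      ∫ (w : Metric.sphere (0 : E3) 1), fderiv ℝ f (x + r • (w : E3)) (w : E3) ∂((volume : Measure E3).toSphere)) ∧
    (∀ r : ℝ, iteratedDeriv 2 (fun ρ : ℝ ↦ ρ * ∫ (w : Metric.sphere (0 : E3) 1), f (x + ρ • (w : E3)) ∂((volume : Measure E3).toSphere)) r =
      r * ∫ (w : Metric.sphere (0 : E3) 1), (∑ i : Fin 3, fderiv ℝ (fun z ↦ fderiv ℝ f z (EuclideanSpace.single i (1 : ℝ)))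
        (x + r • (w : E3)) (EuclideanSpace.single i (1 : ℝ))) ∂((volume : Measure E3).toSphere))

/-- Registered stub R1a-i (statement = `SphereMeanDarboux`, verbatim, unfolded) — LANDED wave 1 (p91959, helper p88341):
`Theorems/StarvedNecksNecksCertifyStubSphereMeanDarboux.lean`. -/
theorem stub_sphereMeanDarboux :
  ∀ (f : E3 → ℝ), ContDiff ℝ ∞ f → ∀ (x : E3),
    ContDiff ℝ ∞ (fun ρ : ℝ ↦ ∫ (w : Metric.sphere (0 : E3) 1), f (x + ρ • (w : E3)) ∂((volume : Measure E3).toSphere)) ∧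
    (∀ r : ℝ, deriv (fun ρ : ℝ ↦ ∫ (w : Metric.sphere (0 : E3) 1), f (x + ρ • (w : E3)) ∂((volume : Measure E3).toSphere)) r =
      ∫ (w : Metric.sphere (0 : E3) 1), fderiv ℝ f (x + r • (w : E3)) (w : E3) ∂((volume : Measure E3).toSphere)) ∧
    (∀ r : ℝ, iteratedDeriv 2 (fun ρ : ℝ ↦ ρ * ∫ (w : Metric.sphere (0 : E3) 1), f (x + ρ • (w : E3)) ∂((volume : Measure E3).toSphere)) r =
      r * ∫ (w : Metric.sphere (0 : E3) 1), (∑ i : Fin 3, fderiv ℝ (fun z ↦ fderiv ℝ f z (EuclideanSpace.single i (1 : ℝ)))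
        (x + r • (w : E3)) (EuclideanSpace.single i (1 : ℝ))) ∂((volume : Measure E3).toSphere)) :=
  Summit.FinalStateConjecture.FinalStateConjecture.Theorems.NecksCertifyTwoCap.Darboux.stub_sphereMeanDarboux

/-- **R1a-ii — calculus of time-dependent spherical means** (classical; Evans §2.4.1).  For a smooth
`ψ : E4 → ℝ`, a spatial centre `x : E3` and `A(s, r) := ∫_{S²} ψ(s, x + r w) dσ(w)` (pinned by its
defining equation, so that the registered text contains no `let`): `A` is jointly smooth on `ℝ²`
(parametric integral of a smooth integrand over a finite measure on a compact space — tree: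
`Literature/Analysis/Calculus/IteratedFDerivParametricIntegral.lean`,
`Literature.Analysis.FunctionSpaces.contDiff_parametric_integral`); `∂ᵣA = ∫ Dψ·(0,w)`,
`∂ₛA = ∫ ∂₀ψ`, `∂ₛ²A = ∫ ∂₀∂₀ψ` (differentiation under the integral); and DARBOUX in the radius,
`∂ᵣ²(r A(s,r)) = r ∫ (Δₓψ)(s, x + rw) dσ` — the hypothesis `SphereMeanDarboux` applied to
`f = ψ ∘ E4.ofTimeSpace s` plus the chain rule through the affine slice map
(`E4.ofTimeSpace s (y) = E4.ofTimeSpace s 0 + L y`, `L (EuclideanSpace.single i 1) = E4.basisVector i.succ`,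
`E4.ofTimeSpace 0 w = L w`).  Size M. -/
def SphericalMeansCalculus : Prop :=
  ∀ (ψ : E4 → ℝ), ContDiff ℝ ∞ ψ → ∀ (x : E3) (A : ℝ → ℝ → ℝ),
    (∀ s r, A s r = ∫ (w : Metric.sphere (0 : E3) 1), ψ (E4.ofTimeSpace s (x + r • (w : E3))) ∂((volume : Measure E3).toSphere)) →
    ContDiff ℝ ∞ (Function.uncurry A) ∧
    (∀ s r, deriv (A s) r =
      ∫ (w : Metric.sphere (0 : E3) 1), fderiv ℝ ψ (E4.ofTimeSpace s (x + r • (w : E3))) (E4.ofTimeSpace 0 (w : E3)) ∂((volume : Measure E3).toSphere)) ∧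
    (∀ s r, deriv (fun s' ↦ A s' r) s =
      ∫ (w : Metric.sphere (0 : E3) 1), fderiv ℝ ψ (E4.ofTimeSpace s (x + r • (w : E3))) (E4.basisVector 0) ∂((volume : Measure E3).toSphere)) ∧
    (∀ s r, iteratedDeriv 2 (fun s' ↦ A s' r) s =
      ∫ (w : Metric.sphere (0 : E3) 1), fderiv ℝ (fun z ↦ fderiv ℝ ψ z (E4.basisVector 0)) (E4.ofTimeSpace s (x + r • (w : E3))) (E4.basisVector 0) ∂((volume : Measure E3).toSphere)) ∧
    (∀ s r, iteratedDeriv 2 (fun ρ ↦ ρ * A s ρ) r =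
      r * ∫ (w : Metric.sphere (0 : E3) 1), (∑ i : Fin 3, fderiv ℝ (fun z ↦ fderiv ℝ ψ z (E4.basisVector i.succ)) (E4.ofTimeSpace s (x + r • (w : E3)))
        (E4.basisVector i.succ)) ∂((volume : Measure E3).toSphere))

/-- Registered stub R1a-ii (statement = `SphereMeanDarboux → SphericalMeansCalculus`, both unfolded) — LANDED wave 1
(p86030): `Theorems/StarvedNecksNecksCertifyStubSphericalMeansCalculus.lean`. -/
theorem stub_sphericalMeansCalculus :
  (∀ (f : E3 → ℝ), ContDiff ℝ ∞ f → ∀ (x : E3),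
    ContDiff ℝ ∞ (fun ρ : ℝ ↦ ∫ (w : Metric.sphere (0 : E3) 1), f (x + ρ • (w : E3)) ∂((volume : Measure E3).toSphere)) ∧
    (∀ r : ℝ, deriv (fun ρ : ℝ ↦ ∫ (w : Metric.sphere (0 : E3) 1), f (x + ρ • (w : E3)) ∂((volume : Measure E3).toSphere)) r =
      ∫ (w : Metric.sphere (0 : E3) 1), fderiv ℝ f (x + r • (w : E3)) (w : E3) ∂((volume : Measure E3).toSphere)) ∧
    (∀ r : ℝ, iteratedDeriv 2 (fun ρ : ℝ ↦ ρ * ∫ (w : Metric.sphere (0 : E3) 1), f (x + ρ • (w : E3)) ∂((volume : Measure E3).toSphere)) r =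
      r * ∫ (w : Metric.sphere (0 : E3) 1), (∑ i : Fin 3, fderiv ℝ (fun z ↦ fderiv ℝ f z (EuclideanSpace.single i (1 : ℝ)))
        (x + r • (w : E3)) (EuclideanSpace.single i (1 : ℝ))) ∂((volume : Measure E3).toSphere))) →
  ∀ (ψ : E4 → ℝ), ContDiff ℝ ∞ ψ → ∀ (x : E3) (A : ℝ → ℝ → ℝ),
    (∀ s r, A s r = ∫ (w : Metric.sphere (0 : E3) 1), ψ (E4.ofTimeSpace s (x + r • (w : E3))) ∂((volume : Measure E3).toSphere)) →
    ContDiff ℝ ∞ (Function.uncurry A) ∧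
    (∀ s r, deriv (A s) r =
      ∫ (w : Metric.sphere (0 : E3) 1), fderiv ℝ ψ (E4.ofTimeSpace s (x + r • (w : E3))) (E4.ofTimeSpace 0 (w : E3)) ∂((volume : Measure E3).toSphere)) ∧
    (∀ s r, deriv (fun s' ↦ A s' r) s =
      ∫ (w : Metric.sphere (0 : E3) 1), fderiv ℝ ψ (E4.ofTimeSpace s (x + r • (w : E3))) (E4.basisVector 0) ∂((volume : Measure E3).toSphere)) ∧
    (∀ s r, iteratedDeriv 2 (fun s' ↦ A s' r) s =
      ∫ (w : Metric.sphere (0 : E3) 1), fderiv ℝ (fun z ↦ fderiv ℝ ψ z (E4.basisVector 0)) (E4.ofTimeSpace s (x + r • (w : E3))) (E4.basisVector 0) ∂((volume : Measure E3).toSphere)) ∧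
    (∀ s r, iteratedDeriv 2 (fun ρ ↦ ρ * A s ρ) r =
      r * ∫ (w : Metric.sphere (0 : E3) 1), (∑ i : Fin 3, fderiv ℝ (fun z ↦ fderiv ℝ ψ z (E4.basisVector i.succ)) (E4.ofTimeSpace s (x + r • (w : E3)))
        (E4.basisVector i.succ)) ∂((volume : Measure E3).toSphere)) :=
  Summit.FinalStateConjecture.FinalStateConjecture.Theorems.NecksCertifyTwoCap.SphericalMeans.stub_sphericalMeansCalculus

/-- **R1b — Kirchhoff–Duhamel representation on `ℝ¹⁺³`** (classical; Evans, PDE, §2.4.1(c) and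
§2.4.2).  For every smooth `ψ : E4 → ℝ`, every point `(t, x)` and every radius `σ > 0`:
`ψ(t,x) = ⨍_{|w|=1} ψ(t−σ, x+σw) + σ ⨍_{|w|=1} (∂ₜ + w·∇)ψ(t−σ, x+σw) − ∫₀^σ s ⨍_{|w|=1} (□_η ψ)(t−s, x+sw) ds`,
where `□_η = −∂ₜ² + Δ`.  REGISTERED as `SphericalMeansCalculus → KirchhoffFormula`.  Proof from R1a-ii
(1+1 reduction, no further sphere geometry): with `A` the spherical means of `ψ` about `x` and
`Ũ(s, r) := r·A(s, r)` (jointly `C²`), R1a-ii gives `Ũₛₛ − Ũᵣᵣ = r ∫ (∂₀∂₀ψ − Δₓψ)(s, x+rw) dσ = −r ∫ (□_ηψ)`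
(unfold `KerrSchild.waveOperator` with the constant diagonal `Kerr.etaComp`: for `C²` functions it is
`−D₀₀ + ∑ᵢ Dᵢᵢ` in nested-`fderiv` form); the incoming derivative `W := Ũₛ + Ũᵣ` satisfies
`(∂ₛ − ∂ᵣ)W = Ũₛₛ − Ũᵣᵣ`, so transport along the characteristic `λ ↦ (t − σ + λ, σ − λ)` gives
`W(t, 0) = W(t − σ, σ) + ∫₀^σ (Ũₛₛ − Ũᵣᵣ)(t − s, s) ds` (tree dictionary: `transport_inRay`-type lemmas of
`Theorems/StarvedNecksNecksCertifyStubCharacteristicCalculus.lean` /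
`Theorems/PhotonSphereChannelsBlindnessWaveCalculus.lean`); finally `Ũ(s, 0) = 0` gives `Ũₛ(t,0) = 0`,
`Ũᵣ(t, 0) = A(t, 0) = σ(S²)·ψ(t, x)`, and `W(t−σ, σ) = ∫ψ + σ∫Dψ·(1, w)` at `(t − σ, x + σw)`
(`E4.ofTimeSpace 1 w = E4.basisVector 0 + E4.ofTimeSpace 0 w`); divide by `σ(S²) ∈ (0, ∞)`
(`Measure.toSphere_apply_univ`).  Size M. -/
def KirchhoffFormula : Prop :=
  ∀ (ψ : E4 → ℝ), ContDiff ℝ ∞ ψ → ∀ (t : ℝ) (x : E3) (σ : ℝ), 0 < σ →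
    ψ (E4.ofTimeSpace t x) =
      (((volume : Measure E3).toSphere univ).toReal)⁻¹ *
          ∫ (w : Metric.sphere (0 : E3) 1), ψ (E4.ofTimeSpace (t - σ) (x + σ • (w : E3)))
            ∂((volume : Measure E3).toSphere)
      + σ * ((((volume : Measure E3).toSphere univ).toReal)⁻¹ *
          ∫ (w : Metric.sphere (0 : E3) 1),
            fderiv ℝ ψ (E4.ofTimeSpace (t - σ) (x + σ • (w : E3))) (E4.ofTimeSpace 1 (w : E3))
            ∂((volume : Measure E3).toSphere))
      - ∫ s in (0 : ℝ)..σ, s * ((((volume : Measure E3).toSphere univ).toReal)⁻¹ *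
          ∫ (w : Metric.sphere (0 : E3) 1),
            KerrSchild.waveOperator (fun _ ↦ Kerr.etaComp) ψ (E4.ofTimeSpace (t - s) (x + s • (w : E3)))
            ∂((volume : Measure E3).toSphere))

/-- Registered stub R1b (statement = `SphericalMeansCalculus → KirchhoffFormula`, both unfolded) — LANDED wave 1 (p87050):
`Theorems/StarvedNecksNecksCertifyStubKirchhoffFormula.lean`. -/
theorem stub_kirchhoffFormula :
  (∀ (ψ : E4 → ℝ), ContDiff ℝ ∞ ψ → ∀ (x : E3) (A : ℝ → ℝ → ℝ),
    (∀ s r, A s r = ∫ (w : Metric.sphere (0 : E3) 1), ψ (E4.ofTimeSpace s (x + r • (w : E3))) ∂((volume : Measure E3).toSphere)) →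
    ContDiff ℝ ∞ (Function.uncurry A) ∧
    (∀ s r, deriv (A s) r =
      ∫ (w : Metric.sphere (0 : E3) 1), fderiv ℝ ψ (E4.ofTimeSpace s (x + r • (w : E3))) (E4.ofTimeSpace 0 (w : E3)) ∂((volume : Measure E3).toSphere)) ∧
    (∀ s r, deriv (fun s' ↦ A s' r) s =
      ∫ (w : Metric.sphere (0 : E3) 1), fderiv ℝ ψ (E4.ofTimeSpace s (x + r • (w : E3))) (E4.basisVector 0) ∂((volume : Measure E3).toSphere)) ∧
    (∀ s r, iteratedDeriv 2 (fun s' ↦ A s' r) s =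
      ∫ (w : Metric.sphere (0 : E3) 1), fderiv ℝ (fun z ↦ fderiv ℝ ψ z (E4.basisVector 0)) (E4.ofTimeSpace s (x + r • (w : E3))) (E4.basisVector 0) ∂((volume : Measure E3).toSphere)) ∧
    (∀ s r, iteratedDeriv 2 (fun ρ ↦ ρ * A s ρ) r =
      r * ∫ (w : Metric.sphere (0 : E3) 1), (∑ i : Fin 3, fderiv ℝ (fun z ↦ fderiv ℝ ψ z (E4.basisVector i.succ)) (E4.ofTimeSpace s (x + r • (w : E3)))
        (E4.basisVector i.succ)) ∂((volume : Measure E3).toSphere))) →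
  ∀ (ψ : E4 → ℝ), ContDiff ℝ ∞ ψ → ∀ (t : ℝ) (x : E3) (σ : ℝ), 0 < σ →
    ψ (E4.ofTimeSpace t x) =
      (((volume : Measure E3).toSphere univ).toReal)⁻¹ *
          ∫ (w : Metric.sphere (0 : E3) 1), ψ (E4.ofTimeSpace (t - σ) (x + σ • (w : E3)))
            ∂((volume : Measure E3).toSphere)
      + σ * ((((volume : Measure E3).toSphere univ).toReal)⁻¹ *
          ∫ (w : Metric.sphere (0 : E3) 1),
            fderiv ℝ ψ (E4.ofTimeSpace (t - σ) (x + σ • (w : E3))) (E4.ofTimeSpace 1 (w : E3))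
            ∂((volume : Measure E3).toSphere))
      - ∫ s in (0 : ℝ)..σ, s * ((((volume : Measure E3).toSphere univ).toReal)⁻¹ *
          ∫ (w : Metric.sphere (0 : E3) 1),
            KerrSchild.waveOperator (fun _ ↦ Kerr.etaComp) ψ (E4.ofTimeSpace (t - s) (x + s • (w : E3)))
            ∂((volume : Measure E3).toSphere)) :=
  Summit.FinalStateConjecture.FinalStateConjecture.Theorems.NecksCertifyTwoCap.Kirchhoff.stub_kirchhoffFormula

/-- **M2 — the Huygens neck lemma (the lever, linearised; TRUE given R1, proof below).**  Let
`φ : E4 → ℝ` be smooth with `□_η φ = 0` on the late exterior `{y⁰ ≥ T, |ȳ| ≥ R₀}` of a cylinder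
(`R₀ > 0`; NOTHING is assumed inside the cylinder — the black box of the hole), and let
`ρ : ℝ → ℝ` be a monotone wall profile, `ρ ≥ R₀ + 2`, sublinear (`ρ(s)/s → 0`).  Suppose
(cyl) the `C³` sup of `φ` on the shells `{y⁰ = s, R₀ ≤ |ȳ| ≤ R₀ + 1}` tends to `0` (the crux's
fixed-radius certificate); (flat) the `C²` sup of `φ` on `{y⁰ = s, |ȳ| ≥ ρ(s)}` tends to `0` (the crux's
unweighted flat certificate); (cone) the CONE LEDGER: for every `e > 0`, for all late apexes `(t, x)` in
the neck (`R₀ + 1 ≤ |x| ≤ ρ(t)`), the squared sizes of the derivatives of orders `1, 2, 3` of `φ`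
integrated over the backward-null-cone shell `{(t − |z − x|, z) : 4ρ(t) ≤ |z − x| ≤ 5ρ(t)}` are at most
`e·ρ(t)` (starvation of the once/twice/thrice-differentiated flux through the collar cones PER UNIT
WALL RADIUS — the geometric mean of the card's two caps in integrated form; bounded commuted energies
are NOT enough, `TRIAGE-r1-1` §B(4) translates satisfy every bounded-energy hypothesis and violate this
one).  THEN the `C²` sup of `φ` on the necks `{y⁰ = s, R₀ + 1 ≤ |ȳ| ≤ ρ(s)}` tends to `0`.
PROOF (given R1): put `ψ := χ(|ȳ|)φ` with a smooth radial cutoff `χ = 0` on `|ȳ| ≤ R₀ + 1/3`, `= 1` on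
`|ȳ| ≥ R₀ + 2/3`; then `□_η ψ = f := 2∇χ·∇φ + φΔχ` is supported in the shell and `‖∂^{≤2} f(s)‖_∞ ≲
(C³ sup of φ on the shell at time s) → 0` by (cyl).  For a late apex `p = (t, x)` in the neck and
`|α| ≤ 2` apply R1 to `∂^α ψ` (smooth, `□_η ∂^αψ = ∂^α f`) with `σ ∈ [4ρ(t), 5ρ(t)]`: the Duhamel term
is `≤ (4π)⁻¹ sup_{s ≥ t−5ρ(t)} ‖∂^α f(s)‖_∞ ∫_{shell} dz/|z − x| ≤ C(R₀)·o(1)` because `t − 5ρ(t) → ∞`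
(own emission is LATE — class (o) of the card, defocusing built into the kernel); the sphere
`{|z − x| = σ}` has `|z| ∈ [3ρ(t), 6ρ(t)]`, hence lies in the flat zone at time `t − σ` (`ρ` monotone),
so the first Kirchhoff term is `≤` the `C²` flat sup at time `t − σ → ∞`; the second is, by
Cauchy–Schwarz on the normalised sphere measure, `≤ (2 I(σ)/4π)^{1/2}` with
`I(σ) = ∫_{|z−x|=σ} ‖D^{|α|+1}φ(t − σ, z)‖² dA`, and `∫_{4ρ}^{5ρ} I(σ) dσ` is exactly the cone-shell
integral of (cone) (polar coordinates about `x`), so some `σ ∈ [4ρ, 5ρ]` has `I(σ) ≤ e` — the focusing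
gain `σ` is cancelled by the one extra derivative under the `L²` average, uniformly in the apex.  All
bounds are uniform in `x`, whence the `supCkENorm` conclusion.  No rate is used anywhere.  Size L
(real analysis: `Measure.toSphere`, polar decomposition `measurePreserving_homeomorphUnitSphereProd`,
interval pigeonhole).  If M2 were false the line would be dead. -/
def HuygensNeckLemma : Prop :=
  ∀ (φ : E4 → ℝ) (T R₀ : ℝ) (ρ : ℝ → ℝ), 0 < R₀ → ContDiff ℝ ∞ φ →
    (∀ y : E4, T ≤ y 0 → R₀ ≤ E4.spatialNorm y →
      KerrSchild.waveOperator (fun _ ↦ Kerr.etaComp) φ y = 0) →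
    Monotone ρ → (∀ s, R₀ + 2 ≤ ρ s) → Tendsto (fun s ↦ ρ s / s) atTop (𝓝 0) →
    Tendsto (fun s ↦ supCkENorm {y : E4 | y 0 = s ∧ R₀ ≤ E4.spatialNorm y ∧ E4.spatialNorm y ≤ R₀ + 1} 3 φ)
      atTop (𝓝 0) →
    Tendsto (fun s ↦ supCkENorm {y : E4 | y 0 = s ∧ ρ s ≤ E4.spatialNorm y} 2 φ) atTop (𝓝 0) →
    (∀ e : ℝ, 0 < e → ∃ S : ℝ, ∀ (t : ℝ) (x : E3), S ≤ t → R₀ + 1 ≤ ‖x‖ → ‖x‖ ≤ ρ t →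
      ∫ z in {z : E3 | 4 * ρ t ≤ ‖z - x‖ ∧ ‖z - x‖ ≤ 5 * ρ t},
          (∑ m ∈ Finset.Icc 1 3, ‖iteratedFDeriv ℝ m φ (E4.ofTimeSpace (t - ‖z - x‖) z)‖ ^ 2)
        ≤ e * ρ t) →
    Tendsto (fun s ↦ supCkENorm
      {y : E4 | y 0 = s ∧ R₀ + 1 ≤ E4.spatialNorm y ∧ E4.spatialNorm y ≤ ρ s} 2 φ) atTop (𝓝 0)

/-- Registered stub M2 (statement = `KirchhoffFormula → HuygensNeckLemma`, both unfolded verbatim) —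
LANDED wave 1 (p104311 `Theorems/StarvedNecksNecksCertifyStubHuygensNeck.lean`, helpers p86997 Wave,
p91022 Cutoff, p88330 Sphere, p101575 SphereMeans); imported (skeleton v4). -/
theorem stub_huygensNeck :
  (∀ (ψ : E4 → ℝ), ContDiff ℝ ∞ ψ → ∀ (t : ℝ) (x : E3) (σ : ℝ), 0 < σ →
    ψ (E4.ofTimeSpace t x) =
      (((volume : Measure E3).toSphere univ).toReal)⁻¹ *
          ∫ (w : Metric.sphere (0 : E3) 1), ψ (E4.ofTimeSpace (t - σ) (x + σ • (w : E3)))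
            ∂((volume : Measure E3).toSphere)
      + σ * ((((volume : Measure E3).toSphere univ).toReal)⁻¹ *
          ∫ (w : Metric.sphere (0 : E3) 1),
            fderiv ℝ ψ (E4.ofTimeSpace (t - σ) (x + σ • (w : E3))) (E4.ofTimeSpace 1 (w : E3))
            ∂((volume : Measure E3).toSphere))
      - ∫ s in (0 : ℝ)..σ, s * ((((volume : Measure E3).toSphere univ).toReal)⁻¹ *
          ∫ (w : Metric.sphere (0 : E3) 1),
            KerrSchild.waveOperator (fun _ ↦ Kerr.etaComp) ψ (E4.ofTimeSpace (t - s) (x + s • (w : E3)))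
            ∂((volume : Measure E3).toSphere))) →
  ∀ (φ : E4 → ℝ) (T R₀ : ℝ) (ρ : ℝ → ℝ), 0 < R₀ → ContDiff ℝ ∞ φ →
    (∀ y : E4, T ≤ y 0 → R₀ ≤ E4.spatialNorm y →
      KerrSchild.waveOperator (fun _ ↦ Kerr.etaComp) φ y = 0) →
    Monotone ρ → (∀ s, R₀ + 2 ≤ ρ s) → Tendsto (fun s ↦ ρ s / s) atTop (𝓝 0) →
    Tendsto (fun s ↦ supCkENorm {y : E4 | y 0 = s ∧ R₀ ≤ E4.spatialNorm y ∧ E4.spatialNorm y ≤ R₀ + 1} 3 φ)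
      atTop (𝓝 0) →
    Tendsto (fun s ↦ supCkENorm {y : E4 | y 0 = s ∧ ρ s ≤ E4.spatialNorm y} 2 φ) atTop (𝓝 0) →
    (∀ e : ℝ, 0 < e → ∃ S : ℝ, ∀ (t : ℝ) (x : E3), S ≤ t → R₀ + 1 ≤ ‖x‖ → ‖x‖ ≤ ρ t →
      ∫ z in {z : E3 | 4 * ρ t ≤ ‖z - x‖ ∧ ‖z - x‖ ≤ 5 * ρ t},
          (∑ m ∈ Finset.Icc 1 3, ‖iteratedFDeriv ℝ m φ (E4.ofTimeSpace (t - ‖z - x‖) z)‖ ^ 2)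
        ≤ e * ρ t) →
    Tendsto (fun s ↦ supCkENorm
      {y : E4 | y 0 = s ∧ R₀ + 1 ≤ E4.spatialNorm y ∧ E4.spatialNorm y ≤ ρ s} 2 φ) atTop (𝓝 0) :=
  Summit.FinalStateConjecture.FinalStateConjecture.Theorems.NecksCertifyTwoCap.Huygens.stub_huygensNeck




/-! ## The typed interface between the analysis (N1a) and the seam (N2) -/

/-- **NeckAtlas** of an input `C⁴` decomposition `d` with honest radius `R₀` — the typed interface
between the ANALYSIS (N1a) and the SEAM (N2).  Lead's reshape (prover-line-…-13549-0, 2026-08-16) of the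
two-cap planner's `NeckCertificate → LedgerAtlas` pair: the audited atlas A1–A13 of the sibling line
`bargmann-small-late-exterior` (N2 worker audit, item evidence `N2-audit-stub_seamSurgery.md`:
A9 `Rg → ∞`, A10 coordinate-disjoint certified tubes, A11 image-disjoint re-gauged tubes, A12 relative
closedness of late `Ψ'`-tube portions, A13 causal covering by the new atlas — none derivable from an
atlas that only certifies), with two adjustments this seam needs: A7/A8 (`C⁰` honesty and
future-directed hole time-lines) hold out to `Rg + 2` (the squash shell of the far-leaf fold and the
anchoring of collar points use comoving lines up to the tube edge), and A13 is asked only for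
COMPATIBLE thresholds (flat-late on a certified tube `+2` ⇒ hole-late), which is all the seam uses
(its `τ₀'` is chosen by `SeamClockRadii`'s last clause) and which is what lets the analysis fatten
flat tubes (the planner's N1b re-centring device) without creating uncovered flat-late/hole-early
annuli.  Data: `R₁ ≥ R₀`, a late time `τ₁ ≥ τ₀`, continuous SUBLINEAR flat-tube profiles
`ρ'ᵢ ≥ R₁ + 1`, `ρ'ᵢ(s) ≥ ρᵢ(s) + 1` for `s ≥ τ₁`, monotone continuous sublinear certified radii
`Rgᵢ ≥ R₁ + 4`, re-gauged hole charts `Ψ'ᵢ` on the boosted Kerr domains, with: (A5) swallowing with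
margin 3; (A1) on `U = {τ₁ < tᵢ, rᵢ < Rgᵢ(tᵢ) + 2}` each `Ψ'ᵢ` is smooth and an open embedding into
the INPUT's charted region; (A2) `Ψ'ᵢ = Ψᵢ` inside `R₁ + 1`; (A3) ONE ATLAS: at flat-late points
outside all `ρ'`-tubes and within `Rgᵢ + 2` of hole `i`, `Ψ'ᵢ = Φ`; (A6) `C²` certification of
`Ψ'ᵢ` against boosted Kerr out to `Rgᵢ(τ)`; (A7) `C⁰` honesty `1/(10‖Λᵢ‖²)` and (A8) future-directed
pushed hole time-lines `Λᵢe₀` on `{τ₁ ≤ tᵢ, R₁ ≤ rᵢ ≤ Rgᵢ + 2}`; (A9)–(A13) as above.  On exact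
boosted Schwarzschild (REVIEW_R2) it holds with `Ψ' = Ψ`.  KNOWN DEFECT (inherited from the crux,
localised here and in N1a only): for comoving multi-hole inputs (`Λᵢe₀ = Λⱼe₀`, the `H` of the landed
`Theorems/NecksCertify/Negative/NecksCertifyFalseOfEqualVelocityBinaryWitness.lean`) A10 is
unsatisfiable together with A9; under the route's repair C′ (pairwise distinct asymptotic
3-velocities in `Hc`) A10 is coordinate geometry. -/
def NeckAtlas (𝓢 : Spacetime.{0} 4) (O : Set 𝓢.carrier) (d : FinalStateDecomposition 𝓢 O 4)
    (R₀ : ℝ) : Prop :=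
  let B := d.background; let t := fun i ↦ (B i).time; let r := fun i ↦ (B i).radius
  let Λ := fun i ↦ ((d.motion i).1 : E4 ≃L[ℝ] E4); let Φ := d.flatChart; let Ψ := d.chart
  let ρ := d.excision
  ∃ (R₁ τ₁ : ℝ) (ρ' Rg : Fin d.N → ℝ → ℝ) (Ψ' : ∀ i, (B i).domain → 𝓢.carrier),
    R₀ ≤ R₁ ∧ d.τ₀ ≤ τ₁ ∧
    (∀ i, Continuous (ρ' i) ∧ Tendsto (fun s ↦ ρ' i s / s) atTop (𝓝 0) ∧
      ∀ s, R₁ + 1 ≤ ρ' i s ∧ (τ₁ ≤ s → ρ i s + 1 ≤ ρ' i s)) ∧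
    (∀ i, Monotone (Rg i) ∧ Continuous (Rg i) ∧ Tendsto (fun s ↦ Rg i s / s) atTop (𝓝 0) ∧
      ∀ s, R₁ + 4 ≤ Rg i s) ∧
    (∀ j (y : E4), τ₁ ≤ y 0 → r j y ≤ ρ' j (y 0) → r j y + 3 ≤ Rg j (t j y)) ∧
    (∀ i, let U : Set (B i).domain := {x | τ₁ < t i x.1 ∧ r i x.1 < Rg i (t i x.1) + 2}
      ContMDiffOn 𝓘(ℝ, E4) (𝓡 4) ∞ (Ψ' i) U ∧ IsOpenEmbedding (U.restrict (Ψ' i)) ∧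
        Ψ' i '' U ⊆ d.charted) ∧
    (∀ i (x : (B i).domain), r i x.1 ≤ R₁ + 1 → Ψ' i x = Ψ i x) ∧
    (∀ i (y : E4) (hy : y ∈ (B i).domain), τ₁ ≤ y 0 → (∀ j, ρ' j (y 0) < r j y) →
      r i y ≤ Rg i (t i y) + 2 → ∃ hy' : y ∈ d.flatDomain, Ψ' i ⟨y, hy⟩ = Φ ⟨y, hy'⟩) ∧
    (∀ i, Tendsto (fun τ ↦ 𝓢.truncDeviationCk (B i) (Ψ' i) 2 (Rg i τ) τ) atTop (𝓝 0)) ∧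
    (∀ i, supCkENorm (Subtype.val '' {x : (B i).domain | τ₁ ≤ t i x.1 ∧ R₁ ≤ r i x.1 ∧
        r i x.1 ≤ Rg i (t i x.1) + 2}) 0 (𝓢.deviationExtend (B i) (Ψ' i)) ≤
      ENNReal.ofReal (1 / (10 * ‖(Λ i : E4 →L[ℝ] E4)‖ ^ 2))) ∧
    (∀ i (x : (B i).domain), τ₁ ≤ t i x.1 → R₁ ≤ r i x.1 → r i x.1 ≤ Rg i (t i x.1) + 2 →
      𝓢.timeOrientation.IsFutureDirected
        (mfderiv 𝓘(ℝ, E4) (𝓡 4) (Ψ' i) x ((Λ i) (E4.basisVector 0)))) ∧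
    -- A9: certified radii exhaust every fixed radius
    (∀ i, Tendsto (Rg i) atTop atTop) ∧
    -- A10: certified tubes (+2) of different holes are coordinate-disjoint at flat-late times
    (∀ j j' (y : E4), j ≠ j' → τ₁ ≤ y 0 → r j y ≤ Rg j (t j y) + 2 → Rg j' (t j' y) + 2 < r j' y) ∧
    -- A11: the re-gauged images of the extended late tubes are pairwise disjoint
    (∀ i j, i ≠ j → Disjoint (Ψ' i '' {x | τ₁ < t i x.1 ∧ r i x.1 < Rg i (t i x.1) + 2})
      (Ψ' j '' {x | τ₁ < t j x.1 ∧ r j x.1 < Rg j (t j x.1) + 2})) ∧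
    -- A12: late Ψ'-tube portions (any continuous profile below Rg + 2) are relatively closed in O
    (∀ i (τ' : ℝ) (ϱ : ℝ → ℝ), Continuous ϱ → τ₁ < τ' → (∀ s, ϱ s < Rg i s + 2) →
      closure (Ψ' i '' {x | τ' ≤ t i x.1 ∧ r i x.1 ≤ ϱ (t i x.1)}) ∩ O ⊆
        Ψ' i '' {x | τ' ≤ t i x.1 ∧ r i x.1 ≤ ϱ (t i x.1)}) ∧
    -- A13: the new atlas covers O causally, for every COMPATIBLE choice of late thresholds
    (∀ (T : ℝ) (Th : Fin d.N → ℝ), τ₁ < T → (∀ j, τ₁ < Th j) →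
      (∀ j (y : E4), T < y 0 → r j y ≤ Rg j (t j y) + 2 → Th j < t j y) →
      O \ (Φ '' {y | T < y.1 0 ∧ ∀ j, ρ' j (y.1 0) < r j y.1} ∪
          ⋃ j, Ψ' j '' {x | Th j < t j x.1 ∧ r j x.1 < Rg j (t j x.1) + 2}) ⊆
        𝓢.metric.causalPast 𝓢.timeOrientation
          (Φ '' {y | y.1 0 = T ∧ ∀ j, ρ' j (y.1 0) < r j y.1} ∪
            ⋃ j, Ψ' j '' {x | t j x.1 = Th j ∧ r j x.1 < Rg j (t j x.1) + 2}))

/-! ## Nonlinear rungs (cycle-2 reshape of N1a: defect ∣ kinematics ∣ analysis ∣ bookkeeping)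

Lead's reshape (2026-08-16, after wave 1 landed R1a-i/R1a-ii/R1b/M2/N2): the former single physics
stub `stub_neckLedgerAnalysis : M2 → R1 → ∀ input, NeckAtlas` is cut along the crux's KNOWN DEFECT.
`stub_distinctVelocities` (DV) isolates the one claim that is false modulo the comoving-binary `H`
(Disproof §4, p73407) and becomes a HYPOTHESIS under the route's repair C′; `stub_coneSeparation`
(provable Lorentz kinematics) turns DV + orthochronicity into the linear cone separation every line
quoted in prose; `stub_neckLedgerAnalysis` (N1a′, the physics, now under DV and therefore believed
TRUE) delivers a drift-free analysis certificate `NeckCertificate`; `stub_chartSurgery` (N1b′,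
bookkeeping) turns certificate + cone separation into the audited `NeckAtlas` (`ρ' := 5ρₐ`,
`Rg := Rc`, `Ψ' := Ψₐ`, A10 from the cones).  Composition unchanged downstream (N2 landed). -/

/-- **DV — pairwise distinct asymptotic four-velocities of the input's holes** (`Λᵢe₀ ≠ Λⱼe₀` for
`i ≠ j`; with orthochronous `Λᵢ` — `Hc`(1) — the same as pairwise distinct 3-velocities).  This is
EXACTLY the conjunct the route's repair C′ adds to `Hc` (rattack EVIDENCE.md §5, Disproof §D). -/
def DistinctVelocities {𝓢 : Spacetime.{0} 4} {O : Set 𝓢.carrier} {k : ℕ}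
    (d : FinalStateDecomposition 𝓢 O k) : Prop :=
  ∀ i j : Fin d.N, i ≠ j →
    ((d.motion i).1 : E4 ≃L[ℝ] E4) (E4.basisVector 0) ≠ ((d.motion j).1 : E4 ≃L[ℝ] E4) (E4.basisVector 0)

/-- **Registered stub DVMulti** (v5 cut of the former `stub_distinctVelocities`; statement =
`∀ honest input with 2 ≤ d.N, DistinctVelocities d`, unfolded).  THE CRUX'S DEFECT, ISOLATED WHERE IT
LIVES: `DistinctVelocities d` is vacuous for `d.N ≤ 1` (proved below, `distinctVelocities_of_multi`), so
only inputs with at least two holes are concerned.  False modulo `ComovingPairWitness` /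
`EqualVelocityBinaryWitness` (a threshold/parabolic head-on binary with honest charts has `Λ₁e₀ = Λ₂e₀`;
`Theorems/NecksCertify/Negative/NecksCertifyFalseOfEqualVelocityBinaryWitness.lean` p73407, Disproof §4,
§G (G2)), not refutable in the tree (no such MGHD is constructible, Disproof §A), and TRUE for the
Christodoulou-generic inputs the route's G (`HonestFixedRadiusSettling`) is about.  Under repair C′ it
is a hypothesis (`Hc` gains the distinct-velocity conjunct verbatim) and this stub disappears.  Held by
the lead; no worker (nothing to prove); `disprover-wanted` answered (gen 1–3). -/
theorem stub_distinctVelocitiesMulti :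
  ∀ (X : Type) [TopologicalSpace X] [ChartedSpace E3 X] [IsManifold (𝓡 3) ∞ X] [ConnectedSpace X]
    (D : InitialDataSet (𝓡 3) X), D ∈ admissibleVacuumData X →
    ∀ 𝒟 : VacuumCauchyDevelopment D, 𝒟.IsMaximal →
    ∀ (O : Set 𝒟.carrier) (d : FinalStateDecomposition 𝒟.toSpacetime O 4) (R₀ : ℝ),
      O = exteriorOf 𝒟.toCauchyDevelopment d.charted →
      HonestCore 𝒟.toSpacetime O 4 d R₀ → HonestFar 𝒟.toSpacetime O 4 d R₀ → 2 ≤ d.N →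
  ∀ i j : Fin d.N, i ≠ j →
    ((d.motion i).1 : E4 ≃L[ℝ] E4) (E4.basisVector 0) ≠ ((d.motion j).1 : E4 ≃L[ℝ] E4) (E4.basisVector 0) := by
  sorry

/-- With at most one hole there is no pair of distinct labels: `DistinctVelocities d` holds vacuously
when `d.N ≤ 1` (two elements of `Fin n`, `n ≤ 1`, are equal). [folklore] -/
theorem distinctVelocities_of_N_le_one {𝓢 : Spacetime.{0} 4} {O : Set 𝓢.carrier} {k : ℕ}
    (d : FinalStateDecomposition 𝓢 O k) (hN : d.N ≤ 1) : DistinctVelocities d := by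
  intro i j hij
  exact (hij (Fin.ext (by have := i.isLt; have := j.isLt; omega))).elim

/-- **DV from DVMulti**: the former registered stub `stub_distinctVelocities` (all honest inputs) follows
from the `2 ≤ d.N` cut, the case `d.N ≤ 1` being vacuous. -/
theorem distinctVelocities_of_multi
    (hm : ∀ (X : Type) [TopologicalSpace X] [ChartedSpace E3 X] [IsManifold (𝓡 3) ∞ X] [ConnectedSpace X]
      (D : InitialDataSet (𝓡 3) X), D ∈ admissibleVacuumData X →
      ∀ 𝒟 : VacuumCauchyDevelopment D, 𝒟.IsMaximal →
      ∀ (O : Set 𝒟.carrier) (d : FinalStateDecomposition 𝒟.toSpacetime O 4) (R₀ : ℝ),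
        O = exteriorOf 𝒟.toCauchyDevelopment d.charted →
        HonestCore 𝒟.toSpacetime O 4 d R₀ → HonestFar 𝒟.toSpacetime O 4 d R₀ → 2 ≤ d.N →
        DistinctVelocities d) :
  ∀ (X : Type) [TopologicalSpace X] [ChartedSpace E3 X] [IsManifold (𝓡 3) ∞ X] [ConnectedSpace X]
    (D : InitialDataSet (𝓡 3) X), D ∈ admissibleVacuumData X →
    ∀ 𝒟 : VacuumCauchyDevelopment D, 𝒟.IsMaximal →
    ∀ (O : Set 𝒟.carrier) (d : FinalStateDecomposition 𝒟.toSpacetime O 4) (R₀ : ℝ),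
      O = exteriorOf 𝒟.toCauchyDevelopment d.charted →
      HonestCore 𝒟.toSpacetime O 4 d R₀ → HonestFar 𝒟.toSpacetime O 4 d R₀ →
      DistinctVelocities d := by
  intro X _ _ _ _ D hD 𝒟 h𝒟 O d R₀ hO hc hf
  rcases le_or_gt d.N 1 with h | h
  · exact distinctVelocities_of_N_le_one d h
  · exact hm X D hD 𝒟 h𝒟 O d R₀ hO hc hf h

/-- **Cone separation** of the input's holes: a slope `c > 0` and a flat time `τc` after which the
coordinate cones `{rᵢ ≤ c·y⁰}` of different holes are disjoint (`rᵢ` = boosted Kerr–Schild radius of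
hole `i`).  The form in which every line used "distinct velocities ⇒ linear separation against
sublinear radii". -/
def ConeSeparation {𝓢 : Spacetime.{0} 4} {O : Set 𝓢.carrier} {k : ℕ}
    (d : FinalStateDecomposition 𝓢 O k) : Prop :=
  ∃ c : ℝ, 0 < c ∧ ∃ τc : ℝ, ∀ (i j : Fin d.N) (y : E4), i ≠ j → τc ≤ y 0 →
    (d.background i).radius y ≤ c * y 0 → c * y 0 < (d.background j).radius y

/-- **Registered stub CS — cone separation from distinct velocities** (M–L, Lorentz kinematics on `E4`)
— LANDED wave 2 (p106992 `Theorems/StarvedNecksNecksCertifyStubConeSeparation.lean`,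
`…Theorems.NecksCertifyTwoCap.Cones.stub_coneSeparation`).  For every final-state decomposition `d` (any `k`) with orthochronous motions
(`(Λᵢe₀)⁰ > 0`, from `Hc`(1)) and pairwise distinct `Λᵢe₀`: `ConeSeparation d`.  Proof sketch: the axis
of hole `i` at flat time `y⁰` sits at `x̄ᵢ(y⁰) = c̄ᵢ + (y⁰ − cᵢ⁰)·v̄ᵢ` with 3-velocity
`v̄ᵢ = spatial(Λᵢe₀)/(Λᵢe₀)⁰`, `|v̄ᵢ| < 1`; orthochronous + `Λᵢe₀ ≠ Λⱼe₀` ⇒ `v̄ᵢ ≠ v̄ⱼ` (both are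
`η`-unit future vectors), so `|x̄ᵢ(y⁰) − x̄ⱼ(y⁰)| ≥ |v̄ᵢ − v̄ⱼ|·y⁰ − C`; the comoving spatial displacement
`spatial(Λᵢ⁻¹(y − cᵢ))` is within factors `[1, ‖Λᵢ⁻¹‖]`-comparable to the flat displacement
`ȳ − x̄ᵢ(y⁰)` along the simultaneity correction (`eq_add_lorentz_poincareInv`,
`abs_flatTime_sub_le` in `Theorems/StarvedNecksNecksCertifyStubSeamSurgeryHelpers.lean`), and the
Kerr–Schild radius satisfies `spatialNorm − |a| ≤ Kerr.radius a ≤ spatialNorm`; hence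
`rᵢ(y) ≤ c·y⁰ ⇒ |ȳ − x̄ᵢ| ≤ ‖Λᵢ‖(c·y⁰ + |aᵢ|) + (clock skew ≲ ‖Λᵢ‖²(c y⁰ + |aᵢ|))` and then
`rⱼ(y) ≥ (|v̄ᵢ − v̄ⱼ| y⁰ − C − …)/‖Λⱼ‖² − |aⱼ| > c·y⁰` for `c` small against
`min |v̄ᵢ − v̄ⱼ| / (‖Λ‖⁴ N-free constants)` and `y⁰` late.  Finite index set: take the min over pairs. -/
theorem stub_coneSeparation :
  ∀ (𝓢 : Spacetime.{0} 4) (O : Set 𝓢.carrier) (k : ℕ) (d : FinalStateDecomposition 𝓢 O k),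
    (∀ i, 0 < ((d.motion i).1 : E4 ≃L[ℝ] E4) (E4.basisVector 0) 0) →
    (∀ i j : Fin d.N, i ≠ j →
      ((d.motion i).1 : E4 ≃L[ℝ] E4) (E4.basisVector 0) ≠ ((d.motion j).1 : E4 ≃L[ℝ] E4) (E4.basisVector 0)) →
    ∃ c : ℝ, 0 < c ∧ ∃ τc : ℝ, ∀ (i j : Fin d.N) (y : E4), i ≠ j → τc ≤ y 0 →
      (d.background i).radius y ≤ c * y 0 → c * y 0 < (d.background j).radius y :=
  Summit.FinalStateConjecture.FinalStateConjecture.Theorems.NecksCertifyTwoCap.Cones.stub_coneSeparation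

/-- **NeckCertificate** (drift-free analysis certificate) of an input `C⁴` decomposition `d` with
honest radius `R₀`: what the ANALYSIS (N1a′) delivers, in its own natural currency — analysis walls
`ρₐᵢ` (flat-time indexed: monotone, continuous, sublinear, `→ ∞`, `≥ R₁ + 1`, `≥ ρᵢ + 1` after `τ₁`),
certified radii `Rcᵢ` (hole-time indexed: monotone, continuous, sublinear, `→ ∞`, `≥ R₁ + 4`, swallowing
the analysis region `rᵢ ≤ 9ρₐᵢ(y⁰)` with margin 3), and re-gauged hole charts `Ψₐᵢ` with: (K4) smooth
open embeddings of the late tubes `{τ₁ < tᵢ, rᵢ < Rcᵢ + 2}` into the input's charted region; (K5)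
`= Ψᵢ` inside `R₁ + 1`; (K6) ONE ATLAS with the input's UNDRIFTED flat chart on the whole flat-late
analysis collar `4ρₐᵢ(y⁰) ≤ rᵢ ≤ Rcᵢ + 2` (the planner's drift `ξᵢ` is blended away INSIDE the
analysis, on `[ρₐ, 4ρₐ]`, where it costs strain `≲ |ξ|/ρₐ → 0` on paper — so no gauge-change estimate
is owed in Lean); (K7) `C²` certification out to `Rcᵢ(τ)`; (K8/K9) `C⁰` honesty `1/(10‖Λᵢ‖²)` and
future-directed `Λᵢe₀`-lines on `R₁ ≤ rᵢ ≤ Rcᵢ + 2` (on the collar these are statements about `Φ`: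
flat certificate + boosted Kerr–Schild tail + the timecone, on paper); (K10) image-disjoint late tubes
of different holes; (K11) relative closedness in `O` of late tube portions; (K12) causal covering of
`O` by the analysis atlas (flat part outside the `5ρₐ`-tubes) for compatible thresholds.  No cone /
coordinate-disjointness clause: that is `ConeSeparation` (kinematics).  Under DV every clause is met
by the intended physics construction; without DV, K6/K7 already fail for a comoving binary (the other
hole sits inside the collar), which is why N1a′ carries DV as an antecedent. -/
def NeckCertificate (𝓢 : Spacetime.{0} 4) (O : Set 𝓢.carrier) (d : FinalStateDecomposition 𝓢 O 4)
    (R₀ : ℝ) : Prop :=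
  let B := d.background; let t := fun i ↦ (B i).time; let r := fun i ↦ (B i).radius
  let Λ := fun i ↦ ((d.motion i).1 : E4 ≃L[ℝ] E4); let Φ := d.flatChart; let Ψ := d.chart
  let ρ := d.excision
  ∃ (R₁ τ₁ : ℝ) (ρa Rc : Fin d.N → ℝ → ℝ) (Ψa : ∀ i, (B i).domain → 𝓢.carrier),
    R₀ ≤ R₁ ∧ d.τ₀ ≤ τ₁ ∧
    -- K1: analysis walls (flat-time indexed)
    (∀ i, Monotone (ρa i) ∧ Continuous (ρa i) ∧ Tendsto (fun s ↦ ρa i s / s) atTop (𝓝 0) ∧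
      Tendsto (ρa i) atTop atTop ∧ ∀ s, R₁ + 1 ≤ ρa i s ∧ (τ₁ ≤ s → ρ i s + 1 ≤ ρa i s)) ∧
    -- K2: certified radii (hole-time indexed), exhausting every radius
    (∀ i, Monotone (Rc i) ∧ Continuous (Rc i) ∧ Tendsto (fun s ↦ Rc i s / s) atTop (𝓝 0) ∧
      Tendsto (Rc i) atTop atTop ∧ ∀ s, R₁ + 4 ≤ Rc i s) ∧
    -- K3: the certified tubes swallow the analysis region with margin 3
    (∀ j (y : E4), τ₁ ≤ y 0 → r j y ≤ 9 * ρa j (y 0) → r j y + 3 ≤ Rc j (t j y)) ∧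
    -- K4: the re-gauged charts on the late tubes
    (∀ i, let U : Set (B i).domain := {x | τ₁ < t i x.1 ∧ r i x.1 < Rc i (t i x.1) + 2}
      ContMDiffOn 𝓘(ℝ, E4) (𝓡 4) ∞ (Ψa i) U ∧ IsOpenEmbedding (U.restrict (Ψa i)) ∧
        Ψa i '' U ⊆ d.charted) ∧
    -- K5: near zone untouched
    (∀ i (x : (B i).domain), r i x.1 ≤ R₁ + 1 → Ψa i x = Ψ i x) ∧
    -- K6: ONE ATLAS on the whole analysis collar `4ρa ≤ rᵢ ≤ Rc + 2` (flat-late)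
    (∀ i (y : E4) (hy : y ∈ (B i).domain), τ₁ ≤ y 0 → 4 * ρa i (y 0) ≤ r i y →
      r i y ≤ Rc i (t i y) + 2 → ∃ hy' : y ∈ d.flatDomain, Ψa i ⟨y, hy⟩ = Φ ⟨y, hy'⟩) ∧
    -- K7: C² certification out to Rc (the analytic content)
    (∀ i, Tendsto (fun τ ↦ 𝓢.truncDeviationCk (B i) (Ψa i) 2 (Rc i τ) τ) atTop (𝓝 0)) ∧
    -- K8/K9: C⁰ honesty and future-directed hole time-lines on `R₁ ≤ rᵢ ≤ Rc + 2`
    (∀ i, supCkENorm (Subtype.val '' {x : (B i).domain | τ₁ ≤ t i x.1 ∧ R₁ ≤ r i x.1 ∧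
        r i x.1 ≤ Rc i (t i x.1) + 2}) 0 (𝓢.deviationExtend (B i) (Ψa i)) ≤
      ENNReal.ofReal (1 / (10 * ‖(Λ i : E4 →L[ℝ] E4)‖ ^ 2))) ∧
    (∀ i (x : (B i).domain), τ₁ ≤ t i x.1 → R₁ ≤ r i x.1 → r i x.1 ≤ Rc i (t i x.1) + 2 →
      𝓢.timeOrientation.IsFutureDirected
        (mfderiv 𝓘(ℝ, E4) (𝓡 4) (Ψa i) x ((Λ i) (E4.basisVector 0)))) ∧
    -- K10: images of different holes' late tubes are disjoint
    (∀ i j, i ≠ j → Disjoint (Ψa i '' {x | τ₁ < t i x.1 ∧ r i x.1 < Rc i (t i x.1) + 2})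
      (Ψa j '' {x | τ₁ < t j x.1 ∧ r j x.1 < Rc j (t j x.1) + 2})) ∧
    -- K11: late tube portions (continuous profiles below Rc + 2) are relatively closed in O
    (∀ i (τ' : ℝ) (ϱ : ℝ → ℝ), Continuous ϱ → τ₁ < τ' → (∀ s, ϱ s < Rc i s + 2) →
      closure (Ψa i '' {x | τ' ≤ t i x.1 ∧ r i x.1 ≤ ϱ (t i x.1)}) ∩ O ⊆
        Ψa i '' {x | τ' ≤ t i x.1 ∧ r i x.1 ≤ ϱ (t i x.1)}) ∧
    -- K12: causal covering by the analysis atlas, for every COMPATIBLE choice of late thresholds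
    (∀ (T : ℝ) (Th : Fin d.N → ℝ), τ₁ < T → (∀ j, τ₁ < Th j) →
      (∀ j (y : E4), T < y 0 → r j y ≤ Rc j (t j y) + 2 → Th j < t j y) →
      O \ (Φ '' {y | T < y.1 0 ∧ ∀ j, 5 * ρa j (y.1 0) < r j y.1} ∪
          ⋃ j, Ψa j '' {x | Th j < t j x.1 ∧ r j x.1 < Rc j (t j x.1) + 2}) ⊆
        𝓢.metric.causalPast 𝓢.timeOrientation
          (Φ '' {y | y.1 0 = T ∧ ∀ j, 5 * ρa j (y.1 0) < r j y.1} ∪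
            ⋃ j, Ψa j '' {x | t j x.1 = Th j ∧ r j x.1 < Rc j (t j x.1) + 2}))

/-- **N1a′ — neck ledger analysis (XL, HARDEST, load-bearing; held by the lead).**  Granted the Huygens
neck lemma (M2) and Kirchhoff's formula (R1b), for EVERY admissible datum `D`, MGHD `𝒟`, region `O`,
`C⁴` decomposition `d` of `O` with `O = exteriorOf 𝒟 d.charted`, `HonestCore(d, R₀)`, `HonestFar(d, R₀)`
AND pairwise distinct asymptotic velocities (DV — the route's repair C′, here an explicit antecedent),
a `NeckCertificate 𝒟 O d R₀` exists.  Intended proof = the planner's N1a (line card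
`Lines/two-cap-focusing-ledger.md`): (1) WALLS `ρₐᵢ` and the flat chart's drift `ξᵢ` (`|ξᵢ| < ρᵢ`),
with `ρₐ ≫ |ξ|/ε(t)` so that the drift is blended away on `[ρₐ, 4ρₐ]`; (2) FAR LEDGER — the cone ledger
of M2 for the curvature components on the collar cones inside the flat-certified zone (order 1 =
energy per unit `ρₐ`: tails of finite integrals, Bondi/Hawking monotonicity; cross-hole content
`(ρₐ/dᵢⱼ)²` with `dᵢⱼ ≥ c·t` FROM DV; Kerr tail `M²/ρₐ²`; order 2 = once-commuted flux; order 3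
incoming by interpolation `o₂`-transport × flat `C⁴` certificate, outgoing by continuity in `t`);
(3) NECK — Klainerman–Rodnianski Kirchhoff–Sobolev parametrix for `□_g Riem = Riem⋆Riem` on the neck
geometry held in `L²`-curvature-flux norms, a-priori `C⁰` bound `Hf`(3), window energy for the `ℓ = 0`
drift, `Hc`(1) for perturbative backscatter/lensing — unweighted `C²` + scale-invariant `C¹` smallness
on the neck exactly as M2 gives it for `□_η`; (4) GAUGE — `Ψₐᵢ` := input chart inside `R₁ + 1`,
parametrix-built Kerr–Schild-type coordinates on the neck, blended to the undrifted `Φ` below `4ρₐ`;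
K10–K12 from `Hf`(3) (near-isometric images of coordinate shells are the physical shells; Disproof
§D/§F(3)) and the covering clause of the input.  USES `Hc`(1), `Hf`(3), sub-extremality, DV.  Why it
might fail: the order-3 incoming ledger entry for angularly wild `o₂` data (TRIAGE-r1-3 (c)), or
non-perturbative accumulation of nonlinearly generated incoming radiation refocused into the neck
(Luk–Oh arXiv:2404.02220; Disproof §F).  Size XL (unprinted: exterior characteristic neck stability).
LANDED TOOLKIT for this stub (helper sub-goals, all `--supports` this item): unconditional Kirchhoff and
Huygens neck lemma (`Theorems/StarvedNecksNecksCertifyKirchhoffHuygens.lean`, p111535); strong Huygens /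
domain of dependence (`…StrongHuygens.lean`, p112122); uniform `t⁻¹` dispersive decay of compactly
supported free data (`…DispersiveDecay.lean`, p113590); cone separation (`…StubConeSeparation.lean`);
and the Theorems-side reduction `necksCertify_repaired_of_neckLedgerAnalysis`
(`…Reduction.lean`, p114116): NecksCertify under repair C′ follows from this stub alone. -/
def NeckLedgerAnalysis : Prop :=
  ∀ (X : Type) [TopologicalSpace X] [ChartedSpace E3 X] [IsManifold (𝓡 3) ∞ X] [ConnectedSpace X]
    (D : InitialDataSet (𝓡 3) X), D ∈ admissibleVacuumData X →
    ∀ 𝒟 : VacuumCauchyDevelopment D, 𝒟.IsMaximal →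
    ∀ (O : Set 𝒟.carrier) (d : FinalStateDecomposition 𝒟.toSpacetime O 4) (R₀ : ℝ),
      O = exteriorOf 𝒟.toCauchyDevelopment d.charted →
      HonestCore 𝒟.toSpacetime O 4 d R₀ → HonestFar 𝒟.toSpacetime O 4 d R₀ →
      DistinctVelocities d → NeckCertificate 𝒟.toSpacetime O d R₀

/-! ### v5 cut of N1a′ by hole count (lead c1, 2026-08-16)

`NeckCertificate` for a HOLE-FREE input (`d.N = 0`) has only its covering clause K12 non-vacuous, and
that clause is typed causal bookkeeping over the input's own flat chart: `O ⊆ I⁻(radiation zone)`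
(`O = exteriorOf 𝒟 d.charted`, `charted = radiationZone` when `N = 0`), flat-late points below `T` are
causally below the flat slab `{y⁰ = T}` (`Hf`(1)) and push-up; a point chronologically below a flat
point ABOVE `T` is reached backwards along the witnessing timelike curve, whose first exit from the
open set `Φ''{y⁰ > T}` lies in its closure, hence (`Hf`(2), vacuous hole conjunct) in `Φ''{y⁰ ≥ T}`,
hence on the slab.  So the `N = 0` case is PROVABLE NOW and is registered separately; the honest
remainder `0 < d.N` (single-hole neck physics for `N = 1`, where DV is vacuous; multi-hole under DV for
`N ≥ 2`) keeps the M2/R1 antecedents and the DV antecedent. -/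

/-- **Registered stub N1a′₀ — the analysis certificate of a hole-free honest input** (`d.N = 0`; M,
causal bookkeeping, see the section docstring) — LANDED p116183
(`Theorems/StarvedNecksNecksCertifyStubNeckLedgerAnalysisZero.lean`, statement with the bundles inlined,
anchor `stub_neckLedgerAnalysisZero_flatCovering`).  Statement = the N1a′ signature without
the model antecedents and without DV (both irrelevant at `N = 0`), with the extra antecedent `d.N = 0`. -/
theorem stub_neckLedgerAnalysisZero :
  ∀ (X : Type) [TopologicalSpace X] [ChartedSpace E3 X] [IsManifold (𝓡 3) ∞ X] [ConnectedSpace X]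
    (D : InitialDataSet (𝓡 3) X), D ∈ admissibleVacuumData X →
    ∀ 𝒟 : VacuumCauchyDevelopment D, 𝒟.IsMaximal →
    ∀ (O : Set 𝒟.carrier) (d : FinalStateDecomposition 𝒟.toSpacetime O 4) (R₀ : ℝ),
      O = exteriorOf 𝒟.toCauchyDevelopment d.charted →
      HonestCore 𝒟.toSpacetime O 4 d R₀ → HonestFar 𝒟.toSpacetime O 4 d R₀ → d.N = 0 →
      NeckCertificate 𝒟.toSpacetime O d R₀ := by
  intro X _ _ _ _ D hD 𝒟 h𝒟 O d R₀ hO hc hf hN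
  exact Summit.FinalStateConjecture.FinalStateConjecture.Theorems.NecksCertifyTwoCap.AnalysisZero.stub_neckLedgerAnalysisZero
    X D hD 𝒟 h𝒟 O d R₀ hO hc hf hN

/-- **Registered stub N1a′₊ — neck ledger analysis with at least one hole** (`0 < d.N`; XL, HARDEST,
the crux's physics; held by the lead).  Statement = the former N1a′ signature
(`HuygensNeckLemma → KirchhoffFormula → ∀ honest input, DV → NeckCertificate`) with the extra antecedent
`0 < d.N`.  For `d.N = 1` the DV antecedent is vacuous: single-hole neck certification carries NO
defect at all. -/
theorem stub_neckLedgerAnalysisPos : HuygensNeckLemma → KirchhoffFormula →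
  ∀ (X : Type) [TopologicalSpace X] [ChartedSpace E3 X] [IsManifold (𝓡 3) ∞ X] [ConnectedSpace X]
    (D : InitialDataSet (𝓡 3) X), D ∈ admissibleVacuumData X →
    ∀ 𝒟 : VacuumCauchyDevelopment D, 𝒟.IsMaximal →
    ∀ (O : Set 𝒟.carrier) (d : FinalStateDecomposition 𝒟.toSpacetime O 4) (R₀ : ℝ),
      O = exteriorOf 𝒟.toCauchyDevelopment d.charted →
      HonestCore 𝒟.toSpacetime O 4 d R₀ → HonestFar 𝒟.toSpacetime O 4 d R₀ →
      (∀ i j : Fin d.N, i ≠ j →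
        ((d.motion i).1 : E4 ≃L[ℝ] E4) (E4.basisVector 0) ≠ ((d.motion j).1 : E4 ≃L[ℝ] E4) (E4.basisVector 0)) →
      0 < d.N → NeckCertificate 𝒟.toSpacetime O d R₀ := by
  sorry

/-- **N1a′ from its two cuts** (former registered stub `stub_neckLedgerAnalysis`, now a theorem modulo
N1a′₀ and N1a′₊): case split on `d.N`. -/
theorem stub_neckLedgerAnalysis
    (h0 : ∀ (X : Type) [TopologicalSpace X] [ChartedSpace E3 X] [IsManifold (𝓡 3) ∞ X] [ConnectedSpace X]
      (D : InitialDataSet (𝓡 3) X), D ∈ admissibleVacuumData X →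
      ∀ 𝒟 : VacuumCauchyDevelopment D, 𝒟.IsMaximal →
      ∀ (O : Set 𝒟.carrier) (d : FinalStateDecomposition 𝒟.toSpacetime O 4) (R₀ : ℝ),
        O = exteriorOf 𝒟.toCauchyDevelopment d.charted →
        HonestCore 𝒟.toSpacetime O 4 d R₀ → HonestFar 𝒟.toSpacetime O 4 d R₀ → d.N = 0 →
        NeckCertificate 𝒟.toSpacetime O d R₀)
    (hpos : HuygensNeckLemma → KirchhoffFormula →
      ∀ (X : Type) [TopologicalSpace X] [ChartedSpace E3 X] [IsManifold (𝓡 3) ∞ X] [ConnectedSpace X]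
        (D : InitialDataSet (𝓡 3) X), D ∈ admissibleVacuumData X →
        ∀ 𝒟 : VacuumCauchyDevelopment D, 𝒟.IsMaximal →
        ∀ (O : Set 𝒟.carrier) (d : FinalStateDecomposition 𝒟.toSpacetime O 4) (R₀ : ℝ),
          O = exteriorOf 𝒟.toCauchyDevelopment d.charted →
          HonestCore 𝒟.toSpacetime O 4 d R₀ → HonestFar 𝒟.toSpacetime O 4 d R₀ →
          DistinctVelocities d → 0 < d.N → NeckCertificate 𝒟.toSpacetime O d R₀) :
    HuygensNeckLemma → KirchhoffFormula →
  ∀ (X : Type) [TopologicalSpace X] [ChartedSpace E3 X] [IsManifold (𝓡 3) ∞ X] [ConnectedSpace X]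
    (D : InitialDataSet (𝓡 3) X), D ∈ admissibleVacuumData X →
    ∀ 𝒟 : VacuumCauchyDevelopment D, 𝒟.IsMaximal →
    ∀ (O : Set 𝒟.carrier) (d : FinalStateDecomposition 𝒟.toSpacetime O 4) (R₀ : ℝ),
      O = exteriorOf 𝒟.toCauchyDevelopment d.charted →
      HonestCore 𝒟.toSpacetime O 4 d R₀ → HonestFar 𝒟.toSpacetime O 4 d R₀ →
      (∀ i j : Fin d.N, i ≠ j →
        ((d.motion i).1 : E4 ≃L[ℝ] E4) (E4.basisVector 0) ≠ ((d.motion j).1 : E4 ≃L[ℝ] E4) (E4.basisVector 0)) →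
      NeckCertificate 𝒟.toSpacetime O d R₀ := by
  intro hM2 hR1 X _ _ _ _ D hD 𝒟 h𝒟 O d R₀ hO hc hf hdv
  rcases Nat.eq_zero_or_pos d.N with h | h
  · exact h0 X D hD 𝒟 h𝒟 O d R₀ hO hc hf h
  · exact hpos hM2 hR1 X D hD 𝒟 h𝒟 O d R₀ hO hc hf hdv h

/-- **N1b′ — chart bookkeeping (M): `NeckCertificate → ConeSeparation → NeckAtlas`.**  Pure real-number
and set bookkeeping over the typed objects (no charts are changed): take `ρ'ᵢ := 5ρₐᵢ`, `Rg := Rc`,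
`Ψ' := Ψₐ`, and a later `τ₁' := max(τ₁, τc, τ_num)`; then A1/A2/A6/A7/A8/A9/A11/A12/A13 are
K4/K5/K7/K8/K9/K2/K10/K11/K12 restricted to the later time, A3 is K6 (a flat-late point outside the
`5ρₐ`-tubes within `Rcᵢ + 2` of hole `i` lies in its collar), A4 is K1 (`5ρₐ` continuous sublinear,
`≥ R₁ + 1`, `≥ ρ + 1`), A5 is K3 (`5ρₐ ≤ 9ρₐ`), and A10 (coordinate-disjoint certified tubes `+2` at
flat-late times) follows from `ConeSeparation` because `Rc` is sublinear in hole time and hole time is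
affinely comparable to flat time on the tubes (`flatTime_mem_Icc` /
`abs_flatTime_sub_le`, landed in `Theorems/StarvedNecksNecksCertifyStubSeamClockRadii.lean` /
`…StubSeamSurgeryHelpers.lean`): `rⱼ ≤ Rcⱼ(tⱼ) + 2 ⇒ rⱼ ≤ c·y⁰` late, hence `c·y⁰ < rⱼ'`, hence
`Rcⱼ'(tⱼ' y) + 2 < rⱼ'` late.  Why it might fail: a mis-set margin — `misstated`, lead re-margins. -/
def ChartSurgery : Prop :=
  ∀ (X : Type) [TopologicalSpace X] [ChartedSpace E3 X] [IsManifold (𝓡 3) ∞ X] [ConnectedSpace X]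
    (D : InitialDataSet (𝓡 3) X), D ∈ admissibleVacuumData X →
    ∀ 𝒟 : VacuumCauchyDevelopment D, 𝒟.IsMaximal →
    ∀ (O : Set 𝒟.carrier) (d : FinalStateDecomposition 𝒟.toSpacetime O 4) (R₀ : ℝ),
      O = exteriorOf 𝒟.toCauchyDevelopment d.charted →
      HonestCore 𝒟.toSpacetime O 4 d R₀ → HonestFar 𝒟.toSpacetime O 4 d R₀ →
      NeckCertificate 𝒟.toSpacetime O d R₀ → ConeSeparation d → NeckAtlas 𝒟.toSpacetime O d R₀

/-- Registered stub N1b′ (statement = `ChartSurgery` with `ConeSeparation` unfolded) — LANDED wave 2 (p107332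
`Theorems/StarvedNecksNecksCertifyStubChartSurgery.lean`, statement with the bundles inlined, anchor
`stub_chartSurgery_coneThreshold`). -/
theorem stub_chartSurgery :
  ∀ (X : Type) [TopologicalSpace X] [ChartedSpace E3 X] [IsManifold (𝓡 3) ∞ X] [ConnectedSpace X]
    (D : InitialDataSet (𝓡 3) X), D ∈ admissibleVacuumData X →
    ∀ 𝒟 : VacuumCauchyDevelopment D, 𝒟.IsMaximal →
    ∀ (O : Set 𝒟.carrier) (d : FinalStateDecomposition 𝒟.toSpacetime O 4) (R₀ : ℝ),
      O = exteriorOf 𝒟.toCauchyDevelopment d.charted →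
      HonestCore 𝒟.toSpacetime O 4 d R₀ → HonestFar 𝒟.toSpacetime O 4 d R₀ →
      NeckCertificate 𝒟.toSpacetime O d R₀ →
      (∃ c : ℝ, 0 < c ∧ ∃ τc : ℝ, ∀ (i j : Fin d.N) (y : E4), i ≠ j → τc ≤ y 0 →
        (d.background i).radius y ≤ c * y 0 → c * y 0 < (d.background j).radius y) →
      NeckAtlas 𝒟.toSpacetime O d R₀ := by
  intro X _ _ _ _ D hD 𝒟 h𝒟 O d R₀ hO hc hf hK hcone
  exact Summit.FinalStateConjecture.FinalStateConjecture.Theorems.NecksCertifyTwoCap.Bookkeeping.stub_chartSurgery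
    X D hD 𝒟 h𝒟 O d R₀ hO hc hf hK hcone

/-! ## Seam rungs (LANDED for the sibling line; statements verbatim, discharged by import) -/

/-- **SFR — restricting the flat chart to a smaller open domain** (verbatim the sibling line's
`SeamFlatRestrict`; LANDED p78126, `Theorems/StarvedNecksNecksCertifyStubSeamFlatRestrict.lean`). -/
def SeamFlatRestrict : Prop :=
  ∀ (𝓢 : Spacetime.{0} 4) (O : Set 𝓢.carrier) (U U' : TopologicalSpace.Opens E4) (hU : U' ≤ U)
    (τ₀ τ₀' : ℝ) (Φ : U → 𝓢.carrier), τ₀ ≤ τ₀' →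
    𝓢.IsLateChart (Minkowski.backgroundOn U) O τ₀ Φ →
    𝓢.IsLateChart (Minkowski.backgroundOn U') O τ₀' (Φ ∘ TopologicalSpace.Opens.inclusion hU) ∧
    (∀ y : U', mfderiv 𝓘(ℝ, E4) (𝓡 4) (Φ ∘ TopologicalSpace.Opens.inclusion hU) y =
      mfderiv 𝓘(ℝ, E4) (𝓡 4) Φ (TopologicalSpace.Opens.inclusion hU y)) ∧
    (∀ y : U', 𝓢.deviation (Minkowski.backgroundOn U') (Φ ∘ TopologicalSpace.Opens.inclusion hU) y =
      𝓢.deviation (Minkowski.backgroundOn U) Φ (TopologicalSpace.Opens.inclusion hU y)) ∧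
    (∀ (k : ℕ) (S : Set U'), supCkENorm (Subtype.val '' S) k
        (𝓢.deviationExtend (Minkowski.backgroundOn U') (Φ ∘ TopologicalSpace.Opens.inclusion hU)) =
      supCkENorm (Subtype.val '' S) k (𝓢.deviationExtend (Minkowski.backgroundOn U) Φ)) ∧
    (∀ (k : ℕ) (τ : ℝ), 𝓢.deviationCk (Minkowski.backgroundOn U') (Φ ∘ TopologicalSpace.Opens.inclusion hU) k τ ≤
      𝓢.deviationCk (Minkowski.backgroundOn U) Φ k τ)

/-- SFR holds (landed theorem, imported). -/
theorem seamFlatRestrict_holds : SeamFlatRestrict :=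
  Summit.FinalStateConjecture.FinalStateConjecture.Theorems.NecksCertifyBargmann.FlatRestrict.stub_seamFlatRestrict

/-- **SCR — re-clocked certified radii** (verbatim the sibling line's `SeamClockRadii`; LANDED p81554,
`Theorems/StarvedNecksNecksCertifyStubSeamClockRadii.lean`): from A4/A5/A10-type numeric data, clock
shifts `sⱼ ≥ 0` and a late `τ₀'` with S1, the raw clock lag, S8, S9, S12 (both time cases) and the
converse comparison (flat-late on a certified tube `+2` ⇒ re-clocked hole time as late as required). -/
def SeamClockRadii : Prop :=
  ∀ (N : ℕ) (Λ : Fin N → lorentzGroup) (c : Fin N → E4) (M a : Fin N → ℝ) (R₁ τ₁ : ℝ)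
    (ρ' Rg : Fin N → ℝ → ℝ) (t r : Fin N → E4 → ℝ),
    (∀ j y, t j y = (boostedKerrBackground (Λ j) (c j) (M j) (a j)).time y) →
    (∀ j y, r j y = (boostedKerrBackground (Λ j) (c j) (M j) (a j)).radius y) →
    (∀ j, 0 < ((Λ j : E4 ≃L[ℝ] E4) (E4.basisVector 0)) 0) →
    (∀ i, Continuous (ρ' i) ∧ ∀ s, R₁ + 1 ≤ ρ' i s) →
    (∀ i, Monotone (Rg i) ∧ Continuous (Rg i) ∧ Tendsto (fun s ↦ Rg i s / s) atTop (𝓝 0) ∧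
      ∀ s, R₁ + 4 ≤ Rg i s) →
    (∀ j (y : E4), τ₁ ≤ y 0 → r j y ≤ ρ' j (y 0) → r j y + 3 ≤ Rg j (t j y)) →
    (∀ j j' (y : E4), j ≠ j' → τ₁ ≤ y 0 → r j y ≤ Rg j (t j y) + 2 → Rg j' (t j' y) + 2 < r j' y) →
    ∃ (s : Fin N → ℝ) (τ₀' : ℝ), τ₁ ≤ τ₀' ∧ (∀ i, 0 ≤ s i) ∧
      (∀ i, Monotone (fun τ ↦ Rg i (τ + s i)) ∧ Continuous (fun τ ↦ Rg i (τ + s i)) ∧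
        ∀ τ, R₁ + 4 ≤ Rg i (τ + s i) ∧ R₁ ≤ ρ' i τ) ∧
      (∀ j (y : E4), τ₁ ≤ t j y → r j y ≤ Rg j (t j y) + 2 → t j y - s j ≤ y 0) ∧
      (∀ j (y : E4), τ₀' ≤ y 0 → r j y ≤ ρ' j (y 0) → r j y + 2 ≤ Rg j (t j y - s j + s j)) ∧
      (∀ j (y : E4), τ₀' ≤ t j y - s j → r j y ≤ Rg j (t j y - s j + s j) + 2 → t j y - s j ≤ y 0) ∧
      (∀ j j' (y : E4), j ≠ j' → (τ₀' ≤ y 0 ∨ τ₀' ≤ t j y - s j) →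
        r j y ≤ Rg j (t j y - s j + s j) + 1 → Rg j' (t j' y - s j' + s j') + 1 < r j' y) ∧
      (∀ T : ℝ, ∃ Y : ℝ, ∀ j (y : E4), Y ≤ y 0 → r j y ≤ Rg j (t j y) + 2 → T ≤ t j y - s j)

/-- Registered stub SCR — LANDED (p81554, `Theorems/StarvedNecksNecksCertifyStubSeamClockRadii.lean`,
`…Theorems.NecksCertifyBargmann.ClockRadii.stub_seamClockRadii`; sibling line), imported (skeleton v2). -/
theorem stub_seamClockRadii :
  ∀ (N : ℕ) (Λ : Fin N → lorentzGroup) (c : Fin N → E4) (M a : Fin N → ℝ) (R₁ τ₁ : ℝ)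
    (ρ' Rg : Fin N → ℝ → ℝ) (t r : Fin N → E4 → ℝ),
    (∀ j y, t j y = (boostedKerrBackground (Λ j) (c j) (M j) (a j)).time y) →
    (∀ j y, r j y = (boostedKerrBackground (Λ j) (c j) (M j) (a j)).radius y) →
    (∀ j, 0 < ((Λ j : E4 ≃L[ℝ] E4) (E4.basisVector 0)) 0) →
    (∀ i, Continuous (ρ' i) ∧ ∀ s, R₁ + 1 ≤ ρ' i s) →
    (∀ i, Monotone (Rg i) ∧ Continuous (Rg i) ∧ Tendsto (fun s ↦ Rg i s / s) atTop (𝓝 0) ∧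
      ∀ s, R₁ + 4 ≤ Rg i s) →
    (∀ j (y : E4), τ₁ ≤ y 0 → r j y ≤ ρ' j (y 0) → r j y + 3 ≤ Rg j (t j y)) →
    (∀ j j' (y : E4), j ≠ j' → τ₁ ≤ y 0 → r j y ≤ Rg j (t j y) + 2 → Rg j' (t j' y) + 2 < r j' y) →
    ∃ (s : Fin N → ℝ) (τ₀' : ℝ), τ₁ ≤ τ₀' ∧ (∀ i, 0 ≤ s i) ∧
      (∀ i, Monotone (fun τ ↦ Rg i (τ + s i)) ∧ Continuous (fun τ ↦ Rg i (τ + s i)) ∧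
        ∀ τ, R₁ + 4 ≤ Rg i (τ + s i) ∧ R₁ ≤ ρ' i τ) ∧
      (∀ j (y : E4), τ₁ ≤ t j y → r j y ≤ Rg j (t j y) + 2 → t j y - s j ≤ y 0) ∧
      (∀ j (y : E4), τ₀' ≤ y 0 → r j y ≤ ρ' j (y 0) → r j y + 2 ≤ Rg j (t j y - s j + s j)) ∧
      (∀ j (y : E4), τ₀' ≤ t j y - s j → r j y ≤ Rg j (t j y - s j + s j) + 2 → t j y - s j ≤ y 0) ∧
      (∀ j j' (y : E4), j ≠ j' → (τ₀' ≤ y 0 ∨ τ₀' ≤ t j y - s j) →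
        r j y ≤ Rg j (t j y - s j + s j) + 1 → Rg j' (t j' y - s j' + s j') + 1 < r j' y) ∧
      (∀ T : ℝ, ∃ Y : ℝ, ∀ j (y : E4), Y ≤ y 0 → r j y ≤ Rg j (t j y) + 2 → T ≤ t j y - s j) :=
  Summit.FinalStateConjecture.FinalStateConjecture.Theorems.NecksCertifyBargmann.ClockRadii.stub_seamClockRadii

/-- **N2 — seam surgery (L–XL packaging).**  For every admissible datum, MGHD, `O`, honest `C⁴`
decomposition `d` (`O = exteriorOf 𝒟 d.charted`, `HonestCore`, `HonestFar`) carrying a `NeckAtlas`,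
there is a `C²` decomposition `d₂` of the SAME `O` with `O = exteriorOf 𝒟 d₂.charted`,
`HonestCore(d₂, R₀')` and `Seamed(d₂, R, R₀')`.  Construction (sibling line's N2 plan + Disproof §5/§E +
`NegativeNotes-stub_seamSurgery.md` (i)–(v)): `d₂` keeps `N, Mᵢ, aᵢ, Λᵢ`; SHIFTS the clocks
`cᵢ ↦ cᵢ + sᵢΛᵢe₀` (`SeamClockRadii`; landed re-clock identities
`Theorems/StarvedNecksNecksCertifyStubSeamSurgeryHelpers`: domain/radius unchanged, time `− sᵢ`, bilinear
form unchanged by stationarity); `τ₀(d₂) := τ₀'` late (flat `C⁰` threshold S3 from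
`tendsto_deviationCk_flat`; flat-late-on-tube ⇒ hole-late by SCR's last clause); hole charts: `Ψ'ᵢ`
pre-composed with a smooth hole-time push `θ` (`= id` above `τ₀'`, image in `{t > τ₁}`) on
`{rᵢ < Rgᵢ + 3/2}`, and `Φ ∘ G ∘ θ` beyond `Rgᵢ + 6/5`, `G` the RADIAL SQUASH of the far leaves into the
collar shell `(Rgᵢ + 6/5, Rgᵢ + 2)` (identity below `Rgᵢ + 3/2`; smooth, injective, open; the two
pieces agree on the overlap by ONE ATLAS A3, the glued map is injective on the late region because
`Ψ'ᵢ` is injective on all of `U ⊇` shell (A1) — this replaces the time-axis fold of Disproof §E and needs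
no clock side condition; far leaves land in the radiation zone, S10); flat domain
`:= {τ₀' − 1 < y⁰, ∀ i ρ'ᵢ(y⁰) < rᵢ}` (open, inside `d.flatDomain`; S7, `flatDomain_late_eq`), flat chart
`:= Φ` restricted (SFR); `R := Rg` re-clocked, `R₀' := R₁`, excision `:= ρ'`.  Structure fields:
fixed-radius `C²` convergence from A6 + A9; `exists_pairwise_disjoint` from A11 + A9; covering clause
from A13 at the compatible thresholds `(τ₀', τ₀' + s)`; `O = exteriorOf 𝒟 d₂.charted` from A13 (at
slightly later compatible thresholds) + push-up + `d₂.charted ⊆ O ⊆ I⁻(d.charted)`.  Clauses: S1, S2,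
S4, S5, S6, S8, S9, S12 are A4/A6/A7/A8/A3/A5/SCR re-clocked; S3 by lateness; S11 from `Hf`(2), A1 and
continuity of `Ψ'ᵢ = Φ` up to the tube wall; `HonestCore(d₂)`: (1) trivially, (4) from `Hc`(4) + SFR,
(2) anchoring from A2 + `Hc`(2) inside `R₁ + 1` and from the future-causal comoving lines (A8, out to
`Rg + 2`) elsewhere, (3) from A12 (+ `Hf`(2) for the squashed shell).  TRUE unconditionally (no
comoving defect: the atlas separates, A9–A11).  Why it might fail: a mis-set margin or clock clause —
`misstated`, repaired by re-margining `NeckAtlas` (lead reshapes). -/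
def SeamSurgery : Prop :=
  ∀ (X : Type) [TopologicalSpace X] [ChartedSpace E3 X] [IsManifold (𝓡 3) ∞ X] [ConnectedSpace X]
    (D : InitialDataSet (𝓡 3) X), D ∈ admissibleVacuumData X →
    ∀ 𝒟 : VacuumCauchyDevelopment D, 𝒟.IsMaximal →
    ∀ (O : Set 𝒟.carrier) (d : FinalStateDecomposition 𝒟.toSpacetime O 4) (R₀ : ℝ),
      O = exteriorOf 𝒟.toCauchyDevelopment d.charted →
      HonestCore 𝒟.toSpacetime O 4 d R₀ → HonestFar 𝒟.toSpacetime O 4 d R₀ →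
      NeckAtlas 𝒟.toSpacetime O d R₀ →
      ∃ (d₂ : FinalStateDecomposition 𝒟.toSpacetime O 2) (R : Fin d₂.N → ℝ → ℝ) (R₀' : ℝ),
        O = exteriorOf 𝒟.toCauchyDevelopment d₂.charted ∧ HonestCore 𝒟.toSpacetime O 2 d₂ R₀' ∧
          Seamed 𝒟.toSpacetime O d₂ R R₀'

/-- Registered stub N2 (statement = `SeamClockRadii → SeamFlatRestrict → SeamSurgery`, the conclusion
unfolded verbatim) — LANDED wave 1 (p94437 `Theorems/StarvedNecksNecksCertifyStubSeamSurgeryMain.lean`,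
statement with the six bundles inlined, defeq to this one; 16 helper layers p86609 Zero, p87394 Smoothing,
p88259 Oblate, p91730 Squash, p90351 Glue, p92013 HoleChart, p90362 Transport, p90366 Ride, p92033 Disc,
p92258 Cover, p92647 Exterior, p92512 Closure, p93072 Hole, p93080 Multi, p93216 Prep, p93361 Clock). -/
theorem stub_seamSurgery : SeamClockRadii → SeamFlatRestrict →
  ∀ (X : Type) [TopologicalSpace X] [ChartedSpace E3 X] [IsManifold (𝓡 3) ∞ X] [ConnectedSpace X]
    (D : InitialDataSet (𝓡 3) X), D ∈ admissibleVacuumData X →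
    ∀ 𝒟 : VacuumCauchyDevelopment D, 𝒟.IsMaximal →
    ∀ (O : Set 𝒟.carrier) (d : FinalStateDecomposition 𝒟.toSpacetime O 4) (R₀ : ℝ),
      O = exteriorOf 𝒟.toCauchyDevelopment d.charted →
      HonestCore 𝒟.toSpacetime O 4 d R₀ → HonestFar 𝒟.toSpacetime O 4 d R₀ →
      NeckAtlas 𝒟.toSpacetime O d R₀ →
      ∃ (d₂ : FinalStateDecomposition 𝒟.toSpacetime O 2) (R : Fin d₂.N → ℝ → ℝ) (R₀' : ℝ),
        O = exteriorOf 𝒟.toCauchyDevelopment d₂.charted ∧ HonestCore 𝒟.toSpacetime O 2 d₂ R₀' ∧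
          Seamed 𝒟.toSpacetime O d₂ R R₀' :=
  Summit.FinalStateConjecture.FinalStateConjecture.Theorems.NecksCertifyTwoCap.Seam.stub_seamSurgery

/-! ## Named forms and registered aliases -/

/-- R1a-i holds (landed). -/
theorem sphereMeanDarboux_holds : SphereMeanDarboux := stub_sphereMeanDarboux
/-- R1a-ii holds (landed). -/
theorem sphericalMeansCalculus_holds : SphericalMeansCalculus :=
  stub_sphericalMeansCalculus stub_sphereMeanDarboux
/-- R1b holds: **Kirchhoff's formula on `ℝ¹⁺³`** (landed chain R1a-i → R1a-ii → R1b, sorry-free). -/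
theorem kirchhoffFormula_holds : KirchhoffFormula :=
  stub_kirchhoffFormula (stub_sphericalMeansCalculus stub_sphereMeanDarboux)
/-- M2 holds: **the Huygens neck lemma** (landed). -/
theorem huygensNeck_holds : HuygensNeckLemma := stub_huygensNeck kirchhoffFormula_holds
theorem neckLedgerAnalysis_holds : HuygensNeckLemma → KirchhoffFormula → NeckLedgerAnalysis :=
  stub_neckLedgerAnalysis stub_neckLedgerAnalysisZero stub_neckLedgerAnalysisPos
theorem coneSeparation_of_distinctVelocities {𝓢 : Spacetime.{0} 4} {O : Set 𝓢.carrier} {k : ℕ}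
    (d : FinalStateDecomposition 𝓢 O k) (horth : ∀ i, 0 < ((d.motion i).1 : E4 ≃L[ℝ] E4) (E4.basisVector 0) 0)
    (hdv : DistinctVelocities d) : ConeSeparation d :=
  stub_coneSeparation 𝓢 O k d horth hdv
theorem chartSurgery_holds : ChartSurgery := stub_chartSurgery
/-- SCR holds (landed, imported). -/
theorem seamClockRadii_holds : SeamClockRadii := stub_seamClockRadii
/-- N2 holds: **the seam** (landed, fed by the landed SCR and SFR). -/
theorem seamSurgery_holds : SeamSurgery := stub_seamSurgery stub_seamClockRadii seamFlatRestrict_holds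

/-! `Registered.stub_X` is the statement of the registered stub `stub_X` under the stub's own short
name, so that the native skeleton audit (`#h21_check_skeleton`: hypotheses admissible iff route items or
registered stubs BY NAME) reads the hypotheses of `NecksCertify_of` as the registered stubs (v2: the two open ones). -/
namespace Registered

/-- Statement of `stub_sphereMeanDarboux`. -/
abbrev stub_sphereMeanDarboux : Prop := SphereMeanDarboux
/-- Statement of `stub_sphericalMeansCalculus`. -/
abbrev stub_sphericalMeansCalculus : Prop := SphereMeanDarboux → SphericalMeansCalculus
/-- Statement of `stub_kirchhoffFormula`. -/
abbrev stub_kirchhoffFormula : Prop := SphericalMeansCalculus → KirchhoffFormula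
/-- Statement of `stub_huygensNeck`. -/
abbrev stub_huygensNeck : Prop := KirchhoffFormula → HuygensNeckLemma
/-- Statement of `stub_distinctVelocitiesMulti` (the isolated defect, `2 ≤ d.N`; v5). -/
abbrev stub_distinctVelocitiesMulti : Prop :=
  ∀ (X : Type) [TopologicalSpace X] [ChartedSpace E3 X] [IsManifold (𝓡 3) ∞ X] [ConnectedSpace X]
    (D : InitialDataSet (𝓡 3) X), D ∈ admissibleVacuumData X →
    ∀ 𝒟 : VacuumCauchyDevelopment D, 𝒟.IsMaximal →
    ∀ (O : Set 𝒟.carrier) (d : FinalStateDecomposition 𝒟.toSpacetime O 4) (R₀ : ℝ),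
      O = exteriorOf 𝒟.toCauchyDevelopment d.charted →
      HonestCore 𝒟.toSpacetime O 4 d R₀ → HonestFar 𝒟.toSpacetime O 4 d R₀ → 2 ≤ d.N →
      DistinctVelocities d
/-- Statement of `stub_coneSeparation`. -/
abbrev stub_coneSeparation : Prop :=
  ∀ (𝓢 : Spacetime.{0} 4) (O : Set 𝓢.carrier) (k : ℕ) (d : FinalStateDecomposition 𝓢 O k),
    (∀ i, 0 < ((d.motion i).1 : E4 ≃L[ℝ] E4) (E4.basisVector 0) 0) → DistinctVelocities d → ConeSeparation d
/-- Statement of `stub_neckLedgerAnalysisZero` (N1a′₀, `d.N = 0`; v5). -/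
abbrev stub_neckLedgerAnalysisZero : Prop :=
  ∀ (X : Type) [TopologicalSpace X] [ChartedSpace E3 X] [IsManifold (𝓡 3) ∞ X] [ConnectedSpace X]
    (D : InitialDataSet (𝓡 3) X), D ∈ admissibleVacuumData X →
    ∀ 𝒟 : VacuumCauchyDevelopment D, 𝒟.IsMaximal →
    ∀ (O : Set 𝒟.carrier) (d : FinalStateDecomposition 𝒟.toSpacetime O 4) (R₀ : ℝ),
      O = exteriorOf 𝒟.toCauchyDevelopment d.charted →
      HonestCore 𝒟.toSpacetime O 4 d R₀ → HonestFar 𝒟.toSpacetime O 4 d R₀ → d.N = 0 →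
      NeckCertificate 𝒟.toSpacetime O d R₀
/-- Statement of `stub_neckLedgerAnalysisPos` (N1a′₊, `0 < d.N`; v5). -/
abbrev stub_neckLedgerAnalysisPos : Prop :=
  HuygensNeckLemma → KirchhoffFormula →
  ∀ (X : Type) [TopologicalSpace X] [ChartedSpace E3 X] [IsManifold (𝓡 3) ∞ X] [ConnectedSpace X]
    (D : InitialDataSet (𝓡 3) X), D ∈ admissibleVacuumData X →
    ∀ 𝒟 : VacuumCauchyDevelopment D, 𝒟.IsMaximal →
    ∀ (O : Set 𝒟.carrier) (d : FinalStateDecomposition 𝒟.toSpacetime O 4) (R₀ : ℝ),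
      O = exteriorOf 𝒟.toCauchyDevelopment d.charted →
      HonestCore 𝒟.toSpacetime O 4 d R₀ → HonestFar 𝒟.toSpacetime O 4 d R₀ →
      DistinctVelocities d → 0 < d.N → NeckCertificate 𝒟.toSpacetime O d R₀
/-- Statement of the former stub `stub_neckLedgerAnalysis` (now a theorem modulo N1a′₀, N1a′₊). -/
abbrev stub_neckLedgerAnalysis : Prop := HuygensNeckLemma → KirchhoffFormula → NeckLedgerAnalysis
/-- Statement of `stub_chartSurgery`. -/
abbrev stub_chartSurgery : Prop := ChartSurgery
/-- Statement of `stub_seamClockRadii` (landed; interim by name). -/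
abbrev stub_seamClockRadii : Prop := SeamClockRadii
/-- Statement of `stub_seamSurgery`. -/
abbrev stub_seamSurgery : Prop := SeamClockRadii → SeamFlatRestrict → SeamSurgery

end Registered

/-- Consistency check: the registered stubs prove their name-keyed statements. -/
example : Registered.stub_sphereMeanDarboux ∧ Registered.stub_sphericalMeansCalculus ∧
    Registered.stub_kirchhoffFormula ∧ Registered.stub_huygensNeck ∧ Registered.stub_distinctVelocitiesMulti ∧
    Registered.stub_coneSeparation ∧ Registered.stub_neckLedgerAnalysisZero ∧
    Registered.stub_neckLedgerAnalysisPos ∧ Registered.stub_neckLedgerAnalysis ∧ Registered.stub_chartSurgery ∧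
    Registered.stub_seamClockRadii ∧ Registered.stub_seamSurgery :=
  ⟨stub_sphereMeanDarboux, stub_sphericalMeansCalculus, stub_kirchhoffFormula, stub_huygensNeck,
    stub_distinctVelocitiesMulti, stub_coneSeparation, stub_neckLedgerAnalysisZero, stub_neckLedgerAnalysisPos,
    stub_neckLedgerAnalysis stub_neckLedgerAnalysisZero stub_neckLedgerAnalysisPos, stub_chartSurgery,
    stub_seamClockRadii, stub_seamSurgery⟩

/-! ## The composition (kernel-checked, no sorry of its own) -/

/-- **Skeleton theorem (v5).**  The TWO open registered stubs — DVMulti (the isolated defect for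
`N ≥ 2` = the route's repair C′) and N1a′₊ (the physics for `N ≥ 1`, under DV) — imply the crux
`StarvedNecks.NecksCertify` BY NAME; R1a-i, R1a-ii, R1b, M2, CS, N1b′, SCR, SFR, N2 and N1a′₀ (the
hole-free certificate, p116183) are all landed and imported:
instance-wise, the seam (N2, its two rungs SCR/SFR landed and imported) applied to the atlas produced by
the analysis (N1a, fed by the Huygens neck lemma M2, itself fed by Kirchhoff R1b ← spherical-means
calculus R1a-ii ← Darboux R1a-i).  The crux's let-bound bundles `Hc`, `Hf`, `Sm` (inlined by the
elaborator) are definitionally this file's `HonestCore`, `HonestFar`, `Seamed` (verbatim bodies), so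
hypotheses and conclusion compose by `exact`. -/
theorem NecksCertify_of (hDVm : Registered.stub_distinctVelocitiesMulti)
    (hPos : Registered.stub_neckLedgerAnalysisPos) :
    Summit.FinalStateConjecture.FinalStateConjecture.Theses.StarvedNecks.NecksCertify := by
  intro X _ _ _ _ D hD 𝒟 h𝒟 O d R₀ hO hc hf
  have hdv : DistinctVelocities d := distinctVelocities_of_multi hDVm X D hD 𝒟 h𝒟 O d R₀ hO hc hf
  have hcone : ConeSeparation d := coneSeparation_of_distinctVelocities d (fun i ↦ (hc.1 i).2.2) hdv
  exact seamSurgery_holds X D hD 𝒟 h𝒟 O d R₀ hO hc hf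
    (chartSurgery_holds X D hD 𝒟 h𝒟 O d R₀ hO hc hf
      (stub_neckLedgerAnalysis stub_neckLedgerAnalysisZero hPos huygensNeck_holds kirchhoffFormula_holds
        X D hD 𝒟 h𝒟 O d R₀ hO hc hf hdv) hcone)


/-- **The crux under the route's repair C′, reduced to the physics stub N1a′₊ alone.**  If `Hc` carried
the distinct-velocity conjunct (repair C′: here an explicit extra antecedent `DistinctVelocities d`), the
re-seaming statement follows from N1a′₊ and the landed rungs only (N1a′₀ landed) — the defect stub
DVMulti is not used.  Kernel-checked form of "NecksCertify[C′] ⇐ NeckLedgerAnalysisPos" (Theorems-side: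
`…Theorems.NecksCertifyTwoCap.ReductionZero.necksCertify_repaired_of_neckLedgerAnalysisPos`, p116546). -/
theorem necksCertify_repaired_of (hPos : Registered.stub_neckLedgerAnalysisPos) :
  ∀ (X : Type) [TopologicalSpace X] [ChartedSpace E3 X] [IsManifold (𝓡 3) ∞ X] [ConnectedSpace X]
    (D : InitialDataSet (𝓡 3) X), D ∈ admissibleVacuumData X →
    ∀ 𝒟 : VacuumCauchyDevelopment D, 𝒟.IsMaximal →
    ∀ (O : Set 𝒟.carrier) (d : FinalStateDecomposition 𝒟.toSpacetime O 4) (R₀ : ℝ),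
      O = exteriorOf 𝒟.toCauchyDevelopment d.charted →
      HonestCore 𝒟.toSpacetime O 4 d R₀ → HonestFar 𝒟.toSpacetime O 4 d R₀ →
      DistinctVelocities d →
      ∃ (d₂ : FinalStateDecomposition 𝒟.toSpacetime O 2) (R : Fin d₂.N → ℝ → ℝ) (R₀' : ℝ),
        O = exteriorOf 𝒟.toCauchyDevelopment d₂.charted ∧ HonestCore 𝒟.toSpacetime O 2 d₂ R₀' ∧
          Seamed 𝒟.toSpacetime O d₂ R R₀' := by
  intro X _ _ _ _ D hD 𝒟 h𝒟 O d R₀ hO hc hf hdv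
  have hcone : ConeSeparation d := coneSeparation_of_distinctVelocities d (fun i ↦ (hc.1 i).2.2) hdv
  exact seamSurgery_holds X D hD 𝒟 h𝒟 O d R₀ hO hc hf
    (chartSurgery_holds X D hD 𝒟 h𝒟 O d R₀ hO hc hf
      (stub_neckLedgerAnalysis stub_neckLedgerAnalysisZero hPos huygensNeck_holds kirchhoffFormula_holds
        X D hD 𝒟 h𝒟 O d R₀ hO hc hf hdv) hcone)

/-- **The crux AS FILED for inputs with at most one hole**, reduced to the physics stub N1a′₊ alone: for
`d.N ≤ 1` the distinct-velocity conjunct is vacuous, so no defect stub is used (v5; Theorems-side: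
`…Theorems.NecksCertifyTwoCap.ReductionZero.necksCertify_N_le_one_of_neckLedgerAnalysisPos`, p116546). -/
theorem necksCertify_of_N_le_one (hPos : Registered.stub_neckLedgerAnalysisPos) :
  ∀ (X : Type) [TopologicalSpace X] [ChartedSpace E3 X] [IsManifold (𝓡 3) ∞ X] [ConnectedSpace X]
    (D : InitialDataSet (𝓡 3) X), D ∈ admissibleVacuumData X →
    ∀ 𝒟 : VacuumCauchyDevelopment D, 𝒟.IsMaximal →
    ∀ (O : Set 𝒟.carrier) (d : FinalStateDecomposition 𝒟.toSpacetime O 4) (R₀ : ℝ),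
      O = exteriorOf 𝒟.toCauchyDevelopment d.charted →
      HonestCore 𝒟.toSpacetime O 4 d R₀ → HonestFar 𝒟.toSpacetime O 4 d R₀ → d.N ≤ 1 →
      ∃ (d₂ : FinalStateDecomposition 𝒟.toSpacetime O 2) (R : Fin d₂.N → ℝ → ℝ) (R₀' : ℝ),
        O = exteriorOf 𝒟.toCauchyDevelopment d₂.charted ∧ HonestCore 𝒟.toSpacetime O 2 d₂ R₀' ∧
          Seamed 𝒟.toSpacetime O d₂ R R₀' :=
  fun X _ _ _ _ D hD 𝒟 h𝒟 O d R₀ hO hc hf hN ↦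
    necksCertify_repaired_of hPos X D hD 𝒟 h𝒟 O d R₀ hO hc hf (distinctVelocities_of_N_le_one d hN)

/-- **The crux AS FILED for hole-free inputs, UNCONDITIONALLY** (v5; Theorems-side:
`…Theorems.NecksCertifyTwoCap.ReductionZero.necksCertify_of_N_eq_zero`, p116546): the landed N1a′₀
suffices when `d.N = 0` (the physics stub is only consulted for `0 < d.N`). -/
theorem necksCertify_of_N_eq_zero :
  ∀ (X : Type) [TopologicalSpace X] [ChartedSpace E3 X] [IsManifold (𝓡 3) ∞ X] [ConnectedSpace X]
    (D : InitialDataSet (𝓡 3) X), D ∈ admissibleVacuumData X →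
    ∀ 𝒟 : VacuumCauchyDevelopment D, 𝒟.IsMaximal →
    ∀ (O : Set 𝒟.carrier) (d : FinalStateDecomposition 𝒟.toSpacetime O 4) (R₀ : ℝ),
      O = exteriorOf 𝒟.toCauchyDevelopment d.charted →
      HonestCore 𝒟.toSpacetime O 4 d R₀ → HonestFar 𝒟.toSpacetime O 4 d R₀ → d.N = 0 →
      ∃ (d₂ : FinalStateDecomposition 𝒟.toSpacetime O 2) (R : Fin d₂.N → ℝ → ℝ) (R₀' : ℝ),
        O = exteriorOf 𝒟.toCauchyDevelopment d₂.charted ∧ HonestCore 𝒟.toSpacetime O 2 d₂ R₀' ∧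
          Seamed 𝒟.toSpacetime O d₂ R R₀' := by
  intro X _ _ _ _ D hD 𝒟 h𝒟 O d R₀ hO hc hf hN
  have hdv : DistinctVelocities d := distinctVelocities_of_N_le_one d (by rw [hN]; exact zero_le_one)
  have hcone : ConeSeparation d := coneSeparation_of_distinctVelocities d (fun i ↦ (hc.1 i).2.2) hdv
  exact seamSurgery_holds X D hD 𝒟 h𝒟 O d R₀ hO hc hf
    (chartSurgery_holds X D hD 𝒟 h𝒟 O d R₀ hO hc hf
      (stub_neckLedgerAnalysisZero X D hD 𝒟 h𝒟 O d R₀ hO hc hf hN) hcone)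

/-- Wiring check: the registered stubs feed `NecksCertify_of` as stated (an `example`, so that
`NecksCertify_of` stays the unique theorem of this file concluding the crux). -/
example : Summit.FinalStateConjecture.FinalStateConjecture.Theses.StarvedNecks.NecksCertify :=
  NecksCertify_of stub_distinctVelocitiesMulti stub_neckLedgerAnalysisPos

end Summit.FinalStateConjecture.FinalStateConjecture.Cruxes.NecksCertify.TwoCapFocusingLedger

end
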